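import Literature.NumberTheory.EllipticCurves.KellerYin2024.AnticyclotomicLocalEulerFactors
import Literature.NumberTheory.IwasawaTheory.PruferPontryaginDual
import HarnessLib

/-!
# Pollack–Weston, *On anticyclotomic μ-invariants of modular forms* (Compositio Math. 147 (2011)
# 1353–1381), Appendix A "Surjectivity of global-to-local maps" (= arXiv:math/0610694 §8):
# Selmer structures over `K_∞`, the local factors `ℋ_v(K_∞, A)` (an explicit object), `δ(K, V)`,
# `r_𝔭`, and **Proposition A.2** (= arXiv Prop. 8.2) — the global-to-local map
# `H¹(K_Σ/K_∞, A) → ∏_{v∈Σ} ℋ_v(K_∞, A)` is SURJECTIVE — as ONE named fact (statement only)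

HONEST FRAMING. Cell `bsd-eis` (FULL-BSD rank ≤ 1 programme, home `run/shared/lean/pub/bsd-eis/`),
unit `bsd-eis-x1-ty1` (literature TYPER, statement lane, director-bsd (165)(a) 2026-08-28), serving
crux 2 `GoodLatticeBDPValue` (stmt-BirchSwinnertonDyer-19032, line `halves` v16) as recommended by
the LEAD verdict v3.1 §3/§3b (`Cruxes/GoodLatticeBDPValue/Lines/halves-lead-verdict.md`): the last
PUB-COMPOSED input of that crux, `KellerYin2024.prop125_residualPair_unrSelmer_corank_ge`
("Pollack–Weston A.2 ∘ CGLS/KY Lemma 1.1.1", file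
`KellerYin2024/AnomalousImprimitiveLambdaInvariants.lean` §7), is composed only because the tree
had no `ℋ_v(K_∞, A)` object. This file supplies that object and PW Prop. A.2 ITSELF, so that a
later prover can DERIVE `prop125_…_corank_ge` (kernel: KY Rem. 1.2.3 (ii) checks (1)–(4); the local
corank `corank ℋ_w = [Γ:Γ_w]·𝟙[θ(Frob_w) ≡ Nw]` is CGLS/KY Lemma 1.1.1). NOTHING is proved about
elliptic curves here; BSD is not advanced by this file; Prop. A.2 is NOT proved here (its proof is
finite-level Poitou–Tate duality with Greenberg's twisting trick, [GV00] Prop. (2.1)); it is a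
NAMED FACT (D-0014: `def … : Prop`, nothing asserted), net debt +1.

## The printed text (store `paper:arxiv-math_0610694`, chunk p0018 L1–75 and p0019; the arXiv
## text numbers App. A as §8, Prop. A.2 as 8.2, Remark A.1 as 8.1; §1 p0004 L3 "Fix an odd prime p")

* p0018 L3–5 (setting): "Let `K` be a number field and let `F` be a finite extension of `ℚ_p`
  with ring of integers `𝒪`. Let `V` be a `F`-representation space for `G_K` of dimension `d`
  which is ramified at only finitely many primes. Let `T` be an `G_K`-stable lattice of `V` and set
  `A = V/T ≅ (K/𝒪)^d` [sic, `(F/𝒪)^d`]. Further, fix a finite set of places `Σ` of `K` containing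
  all places over `p` and `∞` along with all of the ramified primes for `V`."
* p0018 L7–11 (Selmer structures): "Let `L/K` be a (possibly infinite) Galois extension and let
  `Σ_L` denote all of the places of `L` sitting over a place in `Σ`. For `w ∈ Σ_L`, fix a subspace
  `𝓛_w ⊆ H¹(L_w, A)` such that `σ𝓛_w = 𝓛_{σw}` for `σ ∈ Gal(L/K)`. We refer to this as a Selmer
  structure for `A` over `L`. This Selmer structure induces a Selmer group
  `Sel(L, A) = ker ( H¹(K_Σ/L, A) → ∏_{w∈Σ_L} H¹(L_w, A)/𝓛_w )`."
* p0018 L13–33 (induced structures over `K ⊆ M ⊆ L`, `Sel(K_∞, A) = lim_n Sel(K_n, A)`,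
  Remark A.1 on Kobayashi's conditions) — NOT transcribed (not used by the statement of A.2).
* p0018 L43–47: "For `v` a prime of `K`, let `σ_{m,v}` denote the set of places of `K_m` lying over
  `v` and set `ℋ_v(K_∞, A) = lim_m ∏_{w∈σ_{m,v}} H¹(K_{m,w}, A)/𝓛_w`." For `v` FINITELY DECOMPOSED
  in `K_∞` this is the finite product `∏_{w∈σ_{∞,v}} H¹(K_{∞,w}, A)/𝓛_w` over the places of `K_∞`
  above `v` (PW Lemma 3.2 = arXiv p0007 L56–60: "If `ℓ` is split in `K/ℚ`, then `σ_{∞,ℓ}` is finite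
  and `ℋ_ℓ = ∏_{w∈σ_{∞,ℓ}} H¹(K_{∞,w}, A_f)`").
* p0018 L49–54: "`δ(L, V) = Σ_{v complex} d + Σ_{v real} d_v⁻` where `v` runs over archimedean
  places of `L` and `d_v⁻` is the dimension of the `−1` eigenspace of a complex conjugation over `v`
  acting on `V`."
* p0018 L56–59: "If `𝔭` is a prime of `K`, the `Λ`-corank of `𝓛_𝔓` is independent of the choice of
  prime `𝔓` of `K_∞` lying over `𝔭`; we denote it by `r_𝔭`."
* p0018 L61–75, **PROPOSITION A.2** (arXiv 8.2): "Assume that: (1) no place of `K` lying over `p`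
  splits completely in `K_∞`; (2) `Sel(K_∞, A)` is `Λ`-cotorsion; (3) `H⁰(K_∞, A*)` is finite where
  `A* = Hom(T, μ_{p^∞})`; (4) `Σ_{𝔭∣p} r_𝔭 = [K:ℚ]d − δ(K, V)`. Then the global-to-local map
  `H¹(K_∞, A) →γ ∏_{v∈Σ} ℋ_v(K_∞, A)` is surjective." (The source of `γ` is `H¹(K_Σ/K_∞, A)`, the
  group in the definition of `Sel`: proof p0019 L13–16, "`0 → Sel(K_n, A_t) → H¹(K_Σ/K_n, A_t)
  →γ_{n,t} ∏_{v∈Σ_n} H¹(K_{n,v}, A_t)/𝓛_{v,t}`", and "`coker(γ_t) = coker(γ)`".) Proof inputs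
  (p0018 L77 – p0019): [GV00] Prop. (2.1) "with Greenberg's trick of twisting", finite-level
  Poitou–Tate, "`|coker(γ_{n,t})| ≤ |H⁰(K_∞, A*)|`", and "the final equality follows from a direct
  computation as `p ≠ 2`" — `p` is ODD throughout the paper (§1, p0004 L3: "Fix an odd prime `p`").

## Transcription (the tree's tower vocabulary; no notion re-declared)

`K` any number field; `p` an ODD prime (flag `PW-AppA-p-odd`: the proof uses `p ≠ 2`, p0019 L43);
`K_∞` = ANY `ℤ_p`-extension `κ : ZpExtension K p`, `H = ker κ = Gal(K̄/K_∞)`, `γ` with `κ γ = 1`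
(`κ.IsTopGenerator γ`, giving `T = γ − 1` and coset representatives `γ^i` of `Γ/Γ_v`);
`A` = a discrete `Γ_K`-module `M` which is `p`-primary, DIVISIBLE, with open stabilisers and
`M[p]` finite — i.e. `A ≅ (ℚ_p/ℤ_p)^d` as a group, `d = zpCorank M p` ("`𝒪 = ℤ_p` READING": for
`A = (F/𝒪)^d` every hypothesis and the conclusion of A.2 are statements about the underlying
`ℤ_p`-modules — `Λ_𝒪`-cotorsion ⟺ `Λ`-cotorsion, `Λ_𝒪`-coranks and `dim_F` scale by `[F:ℚ_p]` on
both sides of (4) — so nothing is lost); `Σ` ↦ a finite set `S` of FINITE places of `K` containing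
every `v ∣ p` and every place where `M` is ramified (archimedean places OMITTED from `S` and from the
target: for odd `p`, `H¹(K_{m,w}, A) = 0` at archimedean `w`, so `ℋ_v = 0` there and no condition
is imposed — exactly the convention of `GreenbergVatsal2000.GreenbergSelmerGroups`);
`H¹(K_Σ/K_∞, A)` ↦ `GreenbergVatsal2000.unramifiedOutside H M p ↑S` (classes of
`H¹(H, M) = H¹(K_∞, A)` unramified at every place outside `S`, imposed at every conjugate);
`H¹(K_{∞,w₀}, A)` at the place `w₀ ∣ v` of the tree's chosen embedding ↦
`localH1 H M v = H¹(H ⊓ D_v, M)` (`GreenbergSelmer.decomp v`; restriction `locRes`), the other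
places above `v` being reached by `conjH1 H M σ` (as in every Selmer file of the tree).
SCOPE RESTRICTION (special case of print, recorded as `TODO(general form)` on the fact): every
`v ∈ S` is assumed FINITELY DECOMPOSED in `K_∞` (`numPlacesAbove κ v ≠ 0`; this contains
hypothesis (1) and is what Lemma 3.2 calls the split case), so that `ℋ_v(K_∞, A)` is the finite
product above; PW also allow places `v ∤ p` of `Σ` that split completely (`ℋ_v ≅ H¹(K_v, A) ⊗ Λ^∨`),
which needs the finite layers and is not typed here. The consumer's places (KY: `Σ ∖ ∞` = primes
over `pN_E`, all split in the imaginary quadratic `K`, hence finitely decomposed in `K_∞^{ac}` by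
Brink 2007 = tree `exists_mem_decomp_apply_ne_one_of_heegner`) are inside the scope.

* Selmer structure over `K_∞` (p0018 L7–9) ↦ `SelmerStructure H M`: for every finite place `v` an
  additive subgroup `loc v ≤ H¹(H ⊓ D_v, M)` (only the values at `v ∈ S` matter), STABLE under the
  conjugation action `localConj` of the decomposition group `D_v` ("`σ𝓛_w = 𝓛_{σw}`" for `σ` in
  the decomposition group of `w₀`; for `σ` outside it this EQUALITY DEFINES `𝓛_{σw₀}` by transport).
* `Sel(K_∞, A)` (p0018 L10–11) ↦ `SelmerStructure.selmer 𝓛 p S` = `unramifiedOutside ⊓ ⨅_{v∈S}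
  condAt v`, `condAt v = ⨅_σ conj_σ⁻¹(locRes⁻¹(loc v))` ("`res_w c ∈ 𝓛_w` for every `w ∣ v`").
* `ℋ_v(K_∞, A)` (p0018 L43–47, finitely decomposed `v`) ↦ `calH κ 𝓛 v =
  (Fin (numPlacesAbove κ v) → H¹(H ⊓ D_v, M) ⧸ loc v)`: the places of `K_∞` above `v` are the cosets
  `Γ/Γ_v = {γ^i Γ_v : i < [Γ:Γ_v]}` (`Γ ≅ ℤ_p` is procyclic, `[Γ:Γ_v] = numPlacesAbove κ v`, file
  `KellerYin2024/AnticyclotomicLocalEulerFactors`), and the factor at the place `γ^{-i}w₀` is READ IN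
  `H¹(H ⊓ D_v, M) ⧸ loc v` through `conj_{γ^i}` (an isomorphism onto PW's factor
  `H¹(K_{∞,γ^{-i}w₀}, A)/𝓛_{γ^{-i}w₀}` by the `D_v`-stability); the global-to-local map `γ` ↦
  `SelmerStructure.globalToLocal 𝓛 κ γ p S : unramifiedOutside → ∏_{v∈S} calH κ 𝓛 v`,
  `c ↦ (i ↦ [locRes (conj_{γ^i} c)])_v`. A different topological generator or different coset
  representatives change `γ` by factorwise isomorphisms, so its SURJECTIVITY is intrinsic.
* (2) "`Sel(K_∞, A)` is `Λ`-cotorsion" ↦ a Pontryagin-dual datum of `Sel` with its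
  `Λ = ℤ_p⟦T⟧`-structure `T = γ − 1` (`SelmerStructure.IsDualData`, the Prop-valued twin of the
  tree's `GreenbergVatsal2000.DatumDualData`; such data EXIST, `isDualData_self`) whose module is
  finitely generated and `Module.IsTorsion` — the convention of every cotorsion hypothesis in the tree
  (`datumSelmer_nonPrimitive_invariants`, `thm122_rubinHida_residualPair_unrSelmer`).
* (3) "`H⁰(K_∞, A*)` is finite, `A* = Hom(T, μ_{p^∞})`" ↦ through the standard equivalence (for
  divisible `A`, `𝒪 = ℤ_p`): `(A*)^{G_{K_∞}}` is finite ⟺ its divisible part is `0` ⟺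
  `T_p(A*)^{G_{K_∞}} = 0`, and `T_p(A*) = Hom(T, ℤ_p(1)) = Hom(A, ℚ_p/ℤ_p(1))` (`A = T ⊗ ℚ_p/ℤ_p`);
  i.e. EVERY `G_{K_∞}`-EQUIVARIANT HOMOMORPHISM `A → ℚ_p/ℤ_p(1)` IS ZERO, `ℚ_p/ℤ_p(1)` = the tree's
  `QpModZp p` with `h` acting by the cyclotomic character `GaloisRep.cyclotomicCharacter K p h`.
* `δ(K, V)` ↦ `delta K M p = Σ_{w : InfinitePlace K} zpCorank (minusPart M w) p`, `minusPart M w` =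
  the `(−1)`-eigenspace of the non-trivial element of `D_w` (`GreenbergSelmer.decompInf w`; for `p`
  odd `A = A⁺ ⊕ A⁻` and `corank A⁻ = d_w⁻`; at a COMPLEX `w`, `D_w = 1` and `minusPart = M`, giving
  the summand `d` as printed).
* `r_𝔭` "the `Λ`-corank of `𝓛_𝔓`" ↦ `HasLocalCorank κ 𝓛 𝔭 r`: the `Γ_𝔭`-module `𝓛_𝔓 = loc 𝔭`
  (`Γ_𝔭 = D_𝔭H/H ≅ ℤ_p`, acting through `localConj`) has `Λ_𝔭 = ℤ_p⟦Γ_𝔭⟧`-corank `r` in the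
  invariant-growth form `corank_{ℤ_p} (𝓛_𝔓)^{Γ_𝔭^{pⁿ}} = r·pⁿ + O(1)` (`Γ_𝔭^{pⁿ}` ↦ `decompPow κ 𝔭 n`
  = the elements of `D_𝔭` whose image under `κ` is a `pⁿ`-th power in `κ(D_𝔭)`; invariants ↦
  `locInvariants`). This IS "`Λ_𝔭`-corank `r`" for a cofinitely generated `𝓛_𝔓` (structure theory:
  `rank_{ℤ_p} Y/ω_n Y = (rank_Λ Y)·pⁿ + O(1)` for finitely generated `Y`, Greenberg LNM 1716 pp. 61–62,
  the dictionary already used by `IwasawaSelmerCoinvariantGrowthProofs`), and it is the form the proof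
  of A.2 consumes (p0019 L31–33: "`𝓛_{v,t} := 𝓛_{𝔓,t}^{Gal(K_{∞,𝔓}/K_{n,v})}` … has `𝒪`-corank at
  least `r_𝔭[K_{n,v}:K_𝔭]` and exactly this value for all but finitely many `t`").
* (4) ↦ `Σ_{v∈S, v∣p} r v + delta K M p = [K:ℚ]·d` (additive form, no `ℕ`-subtraction).

## Contents (namespace `Literature.NumberTheory.IwasawaTheory.PollackWeston2011`)

§1 `localH1`, `locRes`, `localConjHom`, `localConj`, `locRes_conjH1` (proved compatibility);
§2 `SelmerStructure`, `condAt`, `selmer`, membership lemmas, `conjH1_mem_selmer` (proved);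
§3 `calH` (= `ℋ_v`), `toCalH`, `globalToLocal`, `toCalH_eq_zero_of_mem_condAt` (proved);
§4 `conjSelmer`, `isLocNil_conjSelmer_sub_one`, `IsDualData`, `isDualData_self` (existence, proved);
§5 `minusPart`, `delta`, `decompPow`, `locInvariants`, `HasLocalCorank`;
§6 THE NAMED FACT `propA2_globalToLocal_surjective`;
§7 (appended) `ker γ = Sel(K_∞, A)` — PW's DEFINING EXACT SEQUENCE `0 → Sel → H¹(K_Σ/K_∞, A) →γ ∏ ℋ_v`
(p0018 L10–11, p0019 L13–16, Prop. 5.1 "the defining sequences") for finitely decomposed `Σ`: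
`exists_eq_decomp_mul_pow_mul` (`Γ_K = ⋃_{n<[Γ:Γ_v]} D_v γⁿ H`), `mem_condAt_iff_forall_lt`,
`toCalH_eq_zero_iff_mem_condAt`, `globalToLocal_eq_zero_iff_mem_selmer`, `ker_globalToLocal_eq` (all
proved; with Prop. A.2 they give the exactness `0 → Sel → H¹(K_Σ/K_∞, A) → ∏_{v∈Σ} ℋ_v → 0` the
consumers use).
§8 (appended) THE NON-PRIMITIVE EXACT SEQUENCE `0 → Sel(K_∞, A) → Sel^{Σ₀}(K_∞, A) → ∏_{v∈Σ₀} ℋ_v(K_∞, A)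
→ 0` — Greenberg–Vatsal Cor. (2.3) "`S^{Σ₀}_A(ℚ_∞)/S_A(ℚ_∞) ≅ ∏_{ℓ∈Σ₀} ℋ_ℓ(ℚ_∞)`" / PW Cor. 5.2
"`0 → Sel → 𝔖el → ∏ ℋ_ℓ^un → 0` … immediate from Proposition 5.1", i.e. THE FORM IN WHICH PROP. A.2 IS
CONSUMED, for a general Selmer structure over `K_∞` (all PROVED from the surjectivity of `γ` taken as a
hypothesis; no new fact): `SelmerStructure.relax S₀` (the structure with NO condition at `S₀`, PW's
`Sel^{Σ₀}` / GV's "non-primitive" `S^{Σ₀}`), `relax_loc_of_mem` / `relax_loc_of_not_mem`,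
`condAt_relax_of_mem` / `condAt_relax_of_not_mem`, `mem_selmer_relax_iff`, `selmer_le_selmer_relax`,
`relaxToCalH` (GV's map `S^{Σ₀} → ∏_{v∈Σ₀} ℋ_v`), `relaxToCalH_eq_zero_iff` / `ker_relaxToCalH_eq` (its
kernel is `Sel`), `relaxToCalH_surjective_of_globalToLocal_surjective` (it is ONTO once `γ` is, by
zero-extension and lifting), `relaxQuotientEquiv` (`Sel^{Σ₀}/Sel ≃+ ∏_{v∈Σ₀} ℋ_v`, GV Cor. (2.3) as
printed), and the representative forms `exists_mem_selmer_relax_forall_sub_mem` /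
`exists_mem_selmer_relax_forall_eq` (`loc w = ⊥` on `Σ₀`: for every target tuple `(y_{w,i})` there is
`c ∈ Sel^{Σ₀}` with `res_{w₀}(conj_{γ^i} c) = y_{w,i}`, `w ∈ Σ₀`, `i < [Γ:Γ_w]` — the currency of the
Summit-side consumers of `prop125`).
What is NOT here: induced structures at finite level and Remark A.1; `ℋ_v` at places splitting
completely; Prop. A.2's proof; anything about elliptic curves, characters or `prop125` (the
consumer's kernel work: identify `KellerYin2024.unrSelmer κ (charModule ∅ θ) vbar S₀` with
`SelmerStructure.selmer` for `loc v = ⊤`, `loc v̄ = unramified`, `loc w = ⊤ (w ∈ S₀)`/unramified, and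
`calH` at `w ∈ Sf` with `∏_{η∣w} H¹(K_{∞,η}, A)`; check (1)–(4) as in KY Rem. 1.2.3 (ii)).

## References
* [PollackWeston2011] R. Pollack, T. Weston, Compositio Math. 147 (2011) 1353–1381, App. A
  (Prop. A.2, Remark A.1) = arXiv:math/0610694 §8 (Prop. 8.2); Lemma 3.2; §1 (odd `p`); Prop. 5.1 and
  Cor. 5.2 (arXiv p0013 L8–34: the defining sequences are exact; `0 → Sel → 𝔖el → ∏ ℋ^un → 0`).
* [GreenbergVatsal2000] Invent. Math. 142 (2000), §2 Prop. (2.1) (the model of the proof; `K = ℚ`) and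
  Cor. (2.3) (arXiv:math/9906215, store chunk p0043 L105–118: "Proposition (2.1), together with the fact
  that `ℋ_ℓ(ℚ_∞)` is `Λ`-cotorsion for `ℓ ≠ p`, immediately gives … `S^{Σ₀}_A(ℚ_∞)/S_A(ℚ_∞) ≅
  ∏_{ℓ∈Σ₀} ℋ_ℓ(ℚ_∞)`").
* [Greenberg1989] Adv. Stud. Pure Math. 17, §1 p. 98 (decomposition groups, Selmer groups over `K_∞`).
* [GreenbergLNM1716] §1 pp. 60–62 (`Λ`-module structure on `H¹(K_∞, A)^∨`; coranks of invariants).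
* [KellerYin2024] arXiv:2402.12781v2 Rem. 1.2.3 (ii), Prop. 1.2.5, Rem. 1.4.2 (the consumers' checks
  of (1)–(4)); [CastellaGrossiLeeSkinner2022] Prop. 1.2.5, proof of Thm. 1.5.1 (same use).
-/

noncomputable section

open scoped Classical

open NumberField IsDedekindDomain Field
open Literature.NumberTheory.EllipticCurves Literature.NumberTheory.EllipticCurves.GreenbergSelmer
  Literature.NumberTheory.EllipticCurves.GreenbergVatsal2000
  Literature.NumberTheory.EllipticCurves.KellerYin2024 Literature.NumberTheory.GaloisRepresentations



namespace Literature.NumberTheory.IwasawaTheory.PollackWeston2011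

variable {K : Type} [Field K] [NumberField K]

/-! ## §1 Local cohomology at the chosen place above `v` and the action of `D_v` on it -/

section Local

variable (H : Subgroup (absoluteGaloisGroup K)) (M : Type) [AddCommGroup M]
  [DistribMulAction (absoluteGaloisGroup K) M] [TopologicalSpace M] [DiscreteTopology M]

/-- **`H¹(L_{w₀}, A)` for `L = K̄^H` at the place `w₀ ∣ v` of the chosen embedding**: the continuous
cohomology of the decomposition group `H ⊓ D_v` of `L` at `w₀` (`GreenbergSelmer.decomp v` is the
decomposition group in `Γ_K` of the chosen prime of `K̄` above `v`) with values in the discrete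
module `M` — PW's `H¹(L_w, A)` (p0018 L8), the target of the tree's `GreenbergSelmer.awayKer`
restriction. [cite: PollackWeston2011, App. A (arXiv:math/0610694 §8, p0018 L7–11)]
[cite: Greenberg1989, §1 p. 98] -/
abbrev localH1 (v : HeightOneSpectrum (𝓞 K)) : Type :=
  subgroupH1 (H ⊓ decomp (K := K) v) M

/-- The restriction `res_{w₀} : H¹(L, A) → H¹(L_{w₀}, A)` at the chosen place above `v`
(`resOfLe` along `H ⊓ D_v ≤ H`). [cite: PollackWeston2011, App. A (arXiv:math/0610694 §8, p0018 L10–11)] -/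
abbrev locRes (v : HeightOneSpectrum (𝓞 K)) : subgroupH1 H M →+ localH1 H M v :=
  resOfLe M (inf_le_left : H ⊓ decomp (K := K) v ≤ H)

/-- For `H` normal and `δ ∈ D_v`, `x ↦ δ⁻¹ x δ` preserves `H ⊓ D_v` (private plumbing). [folklore] -/
private theorem conj_mem_inf_decomp [H.Normal] (v : HeightOneSpectrum (𝓞 K)) (δ : decomp (K := K) v)
    (x : ↥(H ⊓ decomp (K := K) v)) :
    (δ : absoluteGaloisGroup K)⁻¹ * x * δ ∈ H ⊓ decomp (K := K) v := by
  refine Subgroup.mem_inf.2 ⟨?_, ?_⟩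
  · simpa only [inv_inv] using
      (inferInstance : H.Normal).conj_mem (x : absoluteGaloisGroup K) (Subgroup.mem_inf.1 x.2).1
        (δ : absoluteGaloisGroup K)⁻¹
  · exact (decomp (K := K) v).mul_mem ((decomp (K := K) v).mul_mem
      ((decomp (K := K) v).inv_mem δ.2) (Subgroup.mem_inf.1 x.2).2) δ.2

variable [H.Normal]

/-- Conjugation `x ↦ δ⁻¹ x δ` by an element `δ` of the decomposition group `D_v` on the local group
`H ⊓ D_v` (which `D_v` normalises, `H` being normal), as a continuous homomorphism — the variance of
the tree's `subgroupConj`. [folklore] -/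
def localConjHom (v : HeightOneSpectrum (𝓞 K)) (δ : decomp (K := K) v) :
    ↥(H ⊓ decomp (K := K) v) →ₜ* ↥(H ⊓ decomp (K := K) v) where
  toFun x := ⟨(δ : absoluteGaloisGroup K)⁻¹ * x * δ, conj_mem_inf_decomp H v δ x⟩
  map_one' := Subtype.ext (by simp)
  map_mul' x y := Subtype.ext (by simp [mul_assoc])
  continuous_toFun := by
    refine Continuous.subtype_mk ?_ _
    exact (continuous_const.mul continuous_subtype_val).mul continuous_const

/-- Unfolding `localConjHom`: `localConjHom H v δ x = δ⁻¹ x δ` (private plumbing). [folklore] -/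
@[simp]
private theorem localConjHom_apply_coe (v : HeightOneSpectrum (𝓞 K)) (δ : decomp (K := K) v)
    (x : ↥(H ⊓ decomp (K := K) v)) :
    ((localConjHom H v δ x : ↥(H ⊓ decomp (K := K) v)) : absoluteGaloisGroup K) =
      (δ : absoluteGaloisGroup K)⁻¹ * x * δ :=
  rfl

/-- **The action of the decomposition group `D_v` on `H¹(L_{w₀}, A)`** (through
`D_v/(H ⊓ D_v) = Gal(L_{w₀}/K_v)`, for `L = K_∞` the local group `Γ_v ≅ ℤ_p` or `1`): the map
induced by the compatible pair `(x ↦ δ⁻¹xδ, m ↦ δ • m)`, as for the tree's global `conjH1`. This is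
the `σ` of PW's "`σ𝓛_w = 𝓛_{σw}`" for `σ` in the decomposition group of `w₀`, and the `Λ_v`-module
structure behind "the `Λ`-corank of `𝓛_𝔓`". [cite: PollackWeston2011, App. A (arXiv:math/0610694 §8, p0018 L7–9, L56–59)]
[cite: Greenberg1989, §1 p. 98] -/
def localConj (v : HeightOneSpectrum (𝓞 K)) (δ : decomp (K := K) v) :
    localH1 H M v →+ localH1 H M v :=
  resH1Hom (localConjHom H v δ) (DistribSMul.toAddMonoidHom M (δ : absoluteGaloisGroup K))
    fun x m ↦ by
      simp only [DistribSMul.toAddMonoidHom_apply, Subgroup.smul_def, localConjHom_apply_coe,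
        smul_smul, mul_assoc, mul_inv_cancel_left]

/-- **Restriction intertwines the global and the local conjugation by `δ ∈ D_v`**:
`res_{w₀} ∘ conj_δ = conj_δ ∘ res_{w₀}` on `H¹(L, A)` (both are induced by the compatible pair
`(x ↦ δ⁻¹xδ : H ⊓ D_v → H, δ • ·)`). Hence a `D_v`-stable local condition pulled back to `H¹(L, A)`
is `D_v`-stable, which is what makes `condAt` below "the condition at every place above `v`".
[cite: NeukirchSchmidtWingberg2008, I.§5] -/
theorem locRes_conjH1 (v : HeightOneSpectrum (𝓞 K)) (δ : decomp (K := K) v) :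
    (locRes H M v).comp (conjH1 H M (δ : absoluteGaloisGroup K)) =
      (localConj H M v δ).comp (locRes H M v) := by
  rw [locRes, resOfLe, conjH1, localConj, resH1Hom_comp, resH1Hom_comp]
  exact resH1Hom_congr (by ext; simp) (by ext; simp) _ _

end Local

/-! ## §2 Selmer structures over `L = K̄^H` and their Selmer groups (PW App. A, p0018 L7–11) -/

section Structure

variable (H : Subgroup (absoluteGaloisGroup K)) [H.Normal] (M : Type) [AddCommGroup M]
  [DistribMulAction (absoluteGaloisGroup K) M] [TopologicalSpace M] [DiscreteTopology M]

/-- **A Selmer structure for `A` over `L = K̄^H`** (PW p0018 L7–9: "For `w ∈ Σ_L`, fix a subspace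
`𝓛_w ⊆ H¹(L_w, A)` such that `σ𝓛_w = 𝓛_{σw}` for `σ ∈ Gal(L/K)`. We refer to this as a Selmer
structure for `A` over `L`"), in the tree's chosen-place formalism: for each finite place `v` of `K`
a subgroup `loc v = 𝓛_{w₀} ≤ H¹(L_{w₀}, A)` at the chosen place `w₀ ∣ v`, stable under the
decomposition group `D_v` (the compatibility `σ𝓛_{w₀} = 𝓛_{σw₀}` for `σ` fixing `w₀`; at the other
places `σw₀` above `v` the condition IS the transport `σ𝓛_{w₀}`, imposed below through `conj_σ`).
Values at places outside the set `S` ("`Σ`") of the Selmer group are never used. "Subspace" (an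
`𝒪`-submodule) is read as an additive subgroup — for the `ℤ_p`-module `H¹(L_w, A)` (`A` `p`-primary)
closed `ℤ_p`-submodules and subgroups killed elementwise by powers of `p` agree; no generality is
claimed beyond PW's. [cite: PollackWeston2011, App. A (arXiv:math/0610694 §8, p0018 L7–9)] -/
structure SelmerStructure where
  /-- The local condition `𝓛_{w₀} ≤ H¹(L_{w₀}, A)` at the chosen place above each finite `v`. -/
  loc : (v : HeightOneSpectrum (𝓞 K)) → AddSubgroup (localH1 H M v)
  /-- `𝓛_{w₀}` is stable under the decomposition group `D_v` ("`σ𝓛_w = 𝓛_{σw}`"). -/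
  localConj_mem : ∀ (v : HeightOneSpectrum (𝓞 K)) (δ : decomp (K := K) v) {x : localH1 H M v},
    x ∈ loc v → localConj H M v δ x ∈ loc v

namespace SelmerStructure

variable {H M} (𝓛 : SelmerStructure H M)

/-- **The condition "`res_w c ∈ 𝓛_w` for EVERY place `w` of `L` above `v`"** as a subgroup of
`H¹(L, A)`: `conj_σ c` restricts into `𝓛_{w₀}` for every `σ ∈ Γ_K` (the places above `v` are the
`Γ_K`-translates of `w₀`; as in `GreenbergSelmer.selmerGroupOver`). [cite: PollackWeston2011, App. A (arXiv:math/0610694 §8, p0018 L10–11)]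
[cite: Greenberg1989, §1 p. 98] -/
def condAt (v : HeightOneSpectrum (𝓞 K)) : AddSubgroup (subgroupH1 H M) :=
  ⨅ σ : absoluteGaloisGroup K, ((𝓛.loc v).comap (locRes H M v)).comap (conjH1 H M σ)

/-- Membership in `condAt`. [cite: PollackWeston2011, App. A (arXiv:math/0610694 §8, p0018 L10–11)] -/
theorem mem_condAt_iff (v : HeightOneSpectrum (𝓞 K)) (c : subgroupH1 H M) :
    c ∈ 𝓛.condAt v ↔ ∀ σ : absoluteGaloisGroup K, locRes H M v (conjH1 H M σ c) ∈ 𝓛.loc v := by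
  simp only [condAt, AddSubgroup.mem_iInf, AddSubgroup.mem_comap]

/-- `condAt v` is stable under `conj_τ`, `τ ∈ Γ_K` (`conj_σ ∘ conj_τ = conj_{στ}`).
[cite: PollackWeston2011, App. A (arXiv:math/0610694 §8, p0018 L7–11)] -/
theorem conjH1_mem_condAt (v : HeightOneSpectrum (𝓞 K)) (τ : absoluteGaloisGroup K)
    {c : subgroupH1 H M} (hc : c ∈ 𝓛.condAt v) : conjH1 H M τ c ∈ 𝓛.condAt v := by
  rw [mem_condAt_iff] at hc ⊢
  intro σ
  have h := hc (σ * τ)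
  rwa [Literature.NumberTheory.EllipticCurves.conjH1_mul_holds H M σ τ,
    AddMonoidHom.comp_apply] at h

variable (p : ℕ) (S : Finset (HeightOneSpectrum (𝓞 K)))

/-- **The Selmer group `Sel(L, A) = ker ( H¹(K_Σ/L, A) → ∏_{w∈Σ_L} H¹(L_w, A)/𝓛_w )`** of the
Selmer structure `𝓛` (PW p0018 L10–11) for `Σ = S ∪ {v ∣ p} ∪ ∞` (intended: `S ⊇ {v ∣ p}`): classes
of `H¹(L, A)` unramified at every place outside `S ∪ {v ∣ p}` (the tree's
`GreenbergVatsal2000.unramifiedOutside H M p ↑S` = PW's `H¹(K_Σ/L, A)`) and satisfying `𝓛` at every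
place above every `v ∈ S` (`condAt`); no archimedean condition (odd `p`).
[cite: PollackWeston2011, App. A (arXiv:math/0610694 §8, p0018 L10–11)]
[cite: GreenbergVatsal2000, §2 pp. 16, 23] -/
def selmer : AddSubgroup (subgroupH1 H M) :=
  unramifiedOutside H M p (↑S : Set (HeightOneSpectrum (𝓞 K))) ⊓ ⨅ v ∈ S, 𝓛.condAt v

/-- Membership in `Sel(L, A)`. [cite: PollackWeston2011, App. A (arXiv:math/0610694 §8, p0018 L10–11)] -/
theorem mem_selmer_iff (c : subgroupH1 H M) :
    c ∈ 𝓛.selmer p S ↔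
      c ∈ unramifiedOutside H M p (↑S : Set (HeightOneSpectrum (𝓞 K))) ∧
        ∀ v ∈ S, c ∈ 𝓛.condAt v := by
  simp only [selmer, AddSubgroup.mem_inf, AddSubgroup.mem_iInf]

/-- `Sel(L, A) ≤ H¹(K_Σ/L, A)`. [cite: PollackWeston2011, App. A (arXiv:math/0610694 §8, p0018 L10–11)] -/
theorem selmer_le_unramifiedOutside :
    𝓛.selmer p S ≤ unramifiedOutside H M p (↑S : Set (HeightOneSpectrum (𝓞 K))) :=
  fun _ hc ↦ ((𝓛.mem_selmer_iff p S _).1 hc).1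

/-- **`Sel(L, A)` is stable under the conjugation action of `Γ_K`** (so that `Γ = Gal(K_∞/K)` acts
and the Pontryagin dual is a `Λ`-module, PW p0019 L3–6). [cite: PollackWeston2011, App. A (arXiv:math/0610694 §8, p0019 L3–6)]
[cite: GreenbergVatsal2000, §2 p. 17] -/
theorem conjH1_mem_selmer (τ : absoluteGaloisGroup K) {c : subgroupH1 H M}
    (hc : c ∈ 𝓛.selmer p S) : conjH1 H M τ c ∈ 𝓛.selmer p S := by
  rw [mem_selmer_iff] at hc ⊢
  exact ⟨conjH1_mem_unramifiedOutside H M p _ τ hc.1, fun v hv ↦ 𝓛.conjH1_mem_condAt v τ (hc.2 v hv)⟩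

end SelmerStructure

end Structure

/-! ## §3 `ℋ_v(K_∞, A)` at a finitely decomposed `v` and the global-to-local map `γ` (p0018 L43–47, L70–73) -/

section Tower

variable {p : ℕ} [Fact p.Prime] (κ : ZpExtension K p) {M : Type} [AddCommGroup M]
  [DistribMulAction (absoluteGaloisGroup K) M] [TopologicalSpace M] [DiscreteTopology M]
  (𝓛 : SelmerStructure κ.kerSubgroup M)

/-- **`ℋ_v(K_∞, A)` for `v` finitely decomposed in `K_∞`** (PW p0018 L43–47:
"`ℋ_v(K_∞, A) = lim_m ∏_{w∈σ_{m,v}} H¹(K_{m,w}, A)/𝓛_w`", which for finite `σ_{∞,v}` is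
`∏_{w∈σ_{∞,v}} H¹(K_{∞,w}, A)/𝓛_w`, PW Lemma 3.2): one factor `H¹(K_{∞,w₀}, A) ⧸ 𝓛_{w₀}` for each of
the `[Γ : Γ_v] = numPlacesAbove κ v` places of `K_∞` above `v`, the place `γ^{-i} w₀`
(`i < [Γ:Γ_v]`, `γ` a topological generator, `Γ/Γ_v` cyclic) being read in the factor at `w₀`
through `conj_{γ^i}` (see `toCalH`). The EMPTY product (junk) when `v` splits completely
(`numPlacesAbove κ v = 0`), a case outside this file's scope.
[cite: PollackWeston2011, App. A (arXiv:math/0610694 §8, p0018 L43–47) and Lemma 3.2 (p0007 L56–60)] -/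
abbrev calH (v : HeightOneSpectrum (𝓞 K)) : Type :=
  Fin (numPlacesAbove κ v) → localH1 κ.kerSubgroup M v ⧸ 𝓛.loc v

namespace SelmerStructure

/-- **The `v`-component `γ_v : H¹(K_∞, A) → ℋ_v(K_∞, A)` of the global-to-local map**:
`c ↦ (res_{w₀}(conj_{γ^i} c) mod 𝓛_{w₀})_{i < [Γ:Γ_v]}` — the restrictions of `c` to the
`[Γ:Γ_v]` places of `K_∞` above `v` modulo the local conditions.
[cite: PollackWeston2011, App. A (arXiv:math/0610694 §8, p0018 L43–47, L70–73)] -/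
def toCalH (γ : absoluteGaloisGroup K) (v : HeightOneSpectrum (𝓞 K)) :
    subgroupH1 κ.kerSubgroup M →+ calH κ 𝓛 v :=
  AddMonoidHom.pi fun i : Fin (numPlacesAbove κ v) ↦
    (QuotientAddGroup.mk' (𝓛.loc v)).comp
      ((locRes κ.kerSubgroup M v).comp (conjH1 κ.kerSubgroup M (γ ^ (i : ℕ))))

/-- Unfolding `toCalH`. [cite: PollackWeston2011, App. A (arXiv:math/0610694 §8, p0018 L43–47)] -/
@[simp]
theorem toCalH_apply (γ : absoluteGaloisGroup K) (v : HeightOneSpectrum (𝓞 K))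
    (c : subgroupH1 κ.kerSubgroup M) (i : Fin (numPlacesAbove κ v)) :
    𝓛.toCalH κ γ v c i = (locRes κ.kerSubgroup M v (conjH1 κ.kerSubgroup M (γ ^ (i : ℕ)) c) :
      localH1 κ.kerSubgroup M v ⧸ 𝓛.loc v) :=
  rfl

/-- A class satisfying `𝓛` at every place above `v` (`condAt v`) dies in `ℋ_v(K_∞, A)`; in
particular `Sel(K_∞, A) ≤ ker γ` (PW: `Sel = ker γ`; the reverse inclusion is the coset bookkeeping
`Γ_K = ⋃_i (D_v H) γ^i` with the `D_v`-stability, not needed for the statement of A.2).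
[cite: PollackWeston2011, App. A (arXiv:math/0610694 §8, p0018 L10–11, L43–47)] -/
theorem toCalH_eq_zero_of_mem_condAt (γ : absoluteGaloisGroup K) (v : HeightOneSpectrum (𝓞 K))
    {c : subgroupH1 κ.kerSubgroup M} (hc : c ∈ 𝓛.condAt v) : 𝓛.toCalH κ γ v c = 0 := by
  funext i
  rw [toCalH_apply, Pi.zero_apply, QuotientAddGroup.eq_zero_iff]
  exact (𝓛.mem_condAt_iff v c).1 hc _

/-- **PW's global-to-local map `γ : H¹(K_Σ/K_∞, A) → ∏_{v∈Σ} ℋ_v(K_∞, A)`** (p0018 L70–73) for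
`Σ ∖ ∞ = S` (every `v ∈ S` finitely decomposed): source `unramifiedOutside H M p ↑S` =
`H¹(K_Σ/K_∞, A)`, components `toCalH`. Prop. A.2 asserts its SURJECTIVITY.
[cite: PollackWeston2011, App. A Prop. A.2 (arXiv:math/0610694 §8 Prop. 8.2, p0018 L70–73)] -/
def globalToLocal (γ : absoluteGaloisGroup K) (S : Finset (HeightOneSpectrum (𝓞 K))) :
    ↥(unramifiedOutside κ.kerSubgroup M p (↑S : Set (HeightOneSpectrum (𝓞 K)))) →+
      ((v : ↥S) → calH κ 𝓛 (v : HeightOneSpectrum (𝓞 K))) :=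
  (AddMonoidHom.pi fun v : ↥S ↦ 𝓛.toCalH κ γ (v : HeightOneSpectrum (𝓞 K))).comp
    (unramifiedOutside κ.kerSubgroup M p (↑S : Set (HeightOneSpectrum (𝓞 K)))).subtype

/-- Unfolding `globalToLocal`. [cite: PollackWeston2011, App. A (arXiv:math/0610694 §8, p0018 L70–73)] -/
@[simp]
theorem globalToLocal_apply (γ : absoluteGaloisGroup K) (S : Finset (HeightOneSpectrum (𝓞 K)))
    (c : ↥(unramifiedOutside κ.kerSubgroup M p (↑S : Set (HeightOneSpectrum (𝓞 K))))) (v : ↥S) :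
    𝓛.globalToLocal κ γ S c v = 𝓛.toCalH κ γ (v : HeightOneSpectrum (𝓞 K)) c :=
  rfl

/-- `Sel(K_∞, A)` is killed by `γ` (componentwise `toCalH_eq_zero_of_mem_condAt`).
[cite: PollackWeston2011, App. A (arXiv:math/0610694 §8, p0018 L10–11)] -/
theorem globalToLocal_eq_zero_of_mem_selmer (γ : absoluteGaloisGroup K)
    (S : Finset (HeightOneSpectrum (𝓞 K)))
    (c : ↥(unramifiedOutside κ.kerSubgroup M p (↑S : Set (HeightOneSpectrum (𝓞 K)))))
    (hc : (c : subgroupH1 κ.kerSubgroup M) ∈ 𝓛.selmer p S) : 𝓛.globalToLocal κ γ S c = 0 := by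
  funext v
  rw [globalToLocal_apply, Pi.zero_apply]
  exact 𝓛.toCalH_eq_zero_of_mem_condAt κ γ _ (((𝓛.mem_selmer_iff p S _).1 hc).2 v v.2)

/-! ## §4 "`Sel(K_∞, A)` is `Λ`-cotorsion": Pontryagin-dual data (hypothesis (2) of Prop. A.2) -/

/-- `conj_τ` as an endomorphism of `Sel(K_∞, A)` (it preserves the group, `conjH1_mem_selmer`): the
action of `Γ` making `Sel(K_∞, A)^∨` a `Λ`-module (PW p0019 L3–6).
[cite: PollackWeston2011, App. A (arXiv:math/0610694 §8, p0019 L3–6)] -/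
def conjSelmer (S : Finset (HeightOneSpectrum (𝓞 K))) (τ : absoluteGaloisGroup K) :
    AddMonoid.End ↥(𝓛.selmer p S) :=
  ((conjH1 κ.kerSubgroup M τ).restrict (𝓛.selmer p S)).codRestrict (𝓛.selmer p S) fun s ↦
    𝓛.conjH1_mem_selmer p S τ s.2

/-- Unfolding `conjSelmer` (private plumbing). [folklore] -/
@[simp]
private theorem coe_conjSelmer_apply (S : Finset (HeightOneSpectrum (𝓞 K))) (τ : absoluteGaloisGroup K)
    (s : ↥(𝓛.selmer p S)) :
    ((𝓛.conjSelmer κ S τ s : ↥(𝓛.selmer p S)) : subgroupH1 κ.kerSubgroup M) =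
      conjH1 κ.kerSubgroup M τ s :=
  rfl

/-- Powers: `(conjSelmer τ)^m = conj_{τ^m}` on classes (`conjH1_one`, `conjH1_mul`; private
plumbing). [folklore] -/
private theorem coe_conjSelmer_pow_apply (S : Finset (HeightOneSpectrum (𝓞 K))) (τ : absoluteGaloisGroup K)
    (m : ℕ) (s : ↥(𝓛.selmer p S)) :
    ((((𝓛.conjSelmer κ S τ) ^ m) s : ↥(𝓛.selmer p S)) : subgroupH1 κ.kerSubgroup M) =
      conjH1 κ.kerSubgroup M (τ ^ m) s := by
  induction m generalizing s with
  | zero => rw [pow_zero, pow_zero, AddMonoid.End.one_apply,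
      Literature.NumberTheory.EllipticCurves.conjH1_one_holds κ.kerSubgroup M, AddMonoidHom.id_apply]
  | succ m ih =>
    rw [pow_succ, AddMonoid.End.coe_mul, Function.comp_apply, ih, coe_conjSelmer_apply, pow_succ,
      Literature.NumberTheory.EllipticCurves.conjH1_mul_holds κ.kerSubgroup M,
      AddMonoidHom.comp_apply]

/-- **`Sel(K_∞, A)` is `p`-primary and `T = γ − 1` is locally nilpotent on it** for `A` `p`-primary
with open stabilisers and `γ` a topological generator (`IwasawaDual.IsLocNil`; tree lemmas
`GreenbergSelmer.exists_pow_smul_subgroupH1_eq_zero` / `exists_conjH1_pow_prime_pow_eq`), so that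
`Hom(Sel(K_∞, A), ℚ/ℤ)` is a `Λ = ℤ_p⟦T⟧`-module (`IwasawaDual.IsLocNil.module`).
[cite: GreenbergLNM1716, §1 (after Conj. 1.3)] -/
theorem isLocNil_conjSelmer_sub_one (S : Finset (HeightOneSpectrum (𝓞 K)))
    (htor : ∀ m : M, ∃ k : ℕ, p ^ k • m = 0)
    (hstab : ∀ m : M,
      IsOpen (MulAction.stabilizer (absoluteGaloisGroup K) m : Set (absoluteGaloisGroup K)))
    {γ : absoluteGaloisGroup K} (hγ : κ.IsTopGenerator γ) :
    IwasawaDual.IsLocNil p (𝓛.conjSelmer κ S γ - 1) := by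
  have htor' : ∀ s : ↥(𝓛.selmer p S), ∃ k : ℕ, p ^ k • s = 0 := fun s ↦ by
    obtain ⟨k, hk⟩ := GreenbergSelmer.exists_pow_smul_subgroupH1_eq_zero κ M htor
      (s : subgroupH1 κ.kerSubgroup M)
    exact ⟨k, Subtype.ext (by rw [AddSubgroupClass.coe_nsmul]; exact hk)⟩
  refine ⟨htor', fun s ↦ ?_⟩
  obtain ⟨a, ha⟩ := GreenbergSelmer.exists_conjH1_pow_prime_pow_eq κ M hstab hγ
    (s : subgroupH1 κ.kerSubgroup M)
  obtain ⟨k, hk⟩ := htor' s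
  have hφ : ((𝓛.conjSelmer κ S γ) ^ p ^ a) s = s :=
    Subtype.ext (by rw [coe_conjSelmer_pow_apply]; exact ha)
  exact ⟨k * p ^ a, IwasawaDual.pow_mul_prime_pow_apply_eq_zero (Fact.out : p.Prime) _ a hφ hk⟩

/-- **Pontryagin-dual data for `Sel(K_∞, A)`** — the Prop-valued form of the tree's
`GreenbergVatsal2000.DatumDualData`: `toDual : X → Hom(Sel(K_∞, A), ℚ/ℤ)` is a group isomorphism
from the `Λ = ℤ_p⟦T⟧`-module `X` under which `T` acts as `conj_γ − 1` and constants `c ∈ ℤ_p` act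
on `p^k`-torsion classes through `ℤ_p → ℤ/p^k`. "`Sel(K_∞, A)` is `Λ`-cotorsion" (hypothesis (2) of
Prop. A.2) is then `Module.Finite Λ X ∧ Module.IsTorsion Λ X` for such an `X` (all such `X` are
isomorphic `Λ`-modules; one EXISTS by `isDualData_self`). PW p0019 L3–6 ("as `Λ`-modules");
GV p. 17. [cite: PollackWeston2011, App. A Prop. A.2 hypothesis (2) (arXiv:math/0610694 §8, p0018 L66; p0019 L3–6)]
[cite: GreenbergVatsal2000, §2 p. 17] -/
structure IsDualData (γ : absoluteGaloisGroup K) (S : Finset (HeightOneSpectrum (𝓞 K)))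
    {X : Type*} [AddCommGroup X] [Module (IwasawaAlgebra p) X]
    (toDual : X →+ (↥(𝓛.selmer p S) →+ AddCircle (1 : ℚ))) : Prop where
  /-- `toDual` is a group isomorphism onto `Hom(Sel(K_∞, A), ℚ/ℤ)`. -/
  bijective : Function.Bijective toDual
  /-- `T` acts as `γ − 1`: `(T·x)(s) = x(conj_γ s) − x(s)`. -/
  toDual_T_smul : ∀ (x : X) (s : ↥(𝓛.selmer p S)),
    toDual ((PowerSeries.X : IwasawaAlgebra p) • x) s =
      toDual x (𝓛.conjSelmer κ S γ s) - toDual x s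
  /-- Constants `c ∈ ℤ_p` act on `p^k`-torsion classes through `ℤ_p → ℤ/p^k`. -/
  toDual_C_smul : ∀ (c : ℤ_[p]) (x : X) (s : ↥(𝓛.selmer p S)) (k : ℕ), (p ^ k) • s = 0 →
    toDual (PowerSeries.C c • x) s = (PadicInt.toZModPow k c).val • toDual x s

/-- **Existence of the dual datum**: `Hom(Sel(K_∞, A), ℚ/ℤ)` with the `Λ`-structure
`IwasawaDual.IsLocNil.module` of `isLocNil_conjSelmer_sub_one` and `toDual = id` IS a dual datum
(for `A` `p`-primary with open stabilisers, `γ` a topological generator) — so hypothesis (2) of the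
fact below is never vacuous. [cite: GreenbergLNM1716, §1 (after Conj. 1.3)]
[cite: GreenbergVatsal2000, §2 p. 17] -/
theorem isDualData_self (S : Finset (HeightOneSpectrum (𝓞 K)))
    (htor : ∀ m : M, ∃ k : ℕ, p ^ k • m = 0)
    (hstab : ∀ m : M,
      IsOpen (MulAction.stabilizer (absoluteGaloisGroup K) m : Set (absoluteGaloisGroup K)))
    {γ : absoluteGaloisGroup K} (hγ : κ.IsTopGenerator γ) :
    letI : Module (IwasawaAlgebra p) (↥(𝓛.selmer p S) →+ AddCircle (1 : ℚ)) :=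
      (𝓛.isLocNil_conjSelmer_sub_one κ S htor hstab hγ).module
    𝓛.IsDualData κ γ S (AddMonoidHom.id (↥(𝓛.selmer p S) →+ AddCircle (1 : ℚ))) := by
  letI : Module (IwasawaAlgebra p) (↥(𝓛.selmer p S) →+ AddCircle (1 : ℚ)) :=
    (𝓛.isLocNil_conjSelmer_sub_one κ S htor hstab hγ).module
  refine ⟨Function.bijective_id, fun x s ↦ ?_, fun c x s k hk ↦ ?_⟩
  · show (𝓛.isLocNil_conjSelmer_sub_one κ S htor hstab hγ).smulFun PowerSeries.X x s = x _ - x s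
    rw [(𝓛.isLocNil_conjSelmer_sub_one κ S htor hstab hγ).smulFun_X_apply,
      IwasawaDual.End_sub_apply, AddMonoid.End.one_apply, map_sub]
  · show (𝓛.isLocNil_conjSelmer_sub_one κ S htor hstab hγ).smulFun (PowerSeries.C c) x s = _
    exact (𝓛.isLocNil_conjSelmer_sub_one κ S htor hstab hγ).smulFun_C_apply c x hk

end SelmerStructure

end Tower

/-! ## §5 `δ(K, V)`, and `r_𝔭` = the `Λ`-corank of `𝓛_𝔓` (p0018 L49–59) -/

section Invariants

variable (M : Type) [AddCommGroup M] [DistribMulAction (absoluteGaloisGroup K) M]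

/-- **The `(−1)`-eigenspace at the archimedean place `w`**: the elements of `A` on which every
non-trivial element of the decomposition group `D_w` (`GreenbergSelmer.decompInf w`, of order `2` at
a real `w`, trivial at a complex `w`) acts by `−1` — for a real `w` the `−1` eigenspace "of a
complex conjugation over `v` acting on" `A` (its `ℤ_p`-corank is PW's `d_v⁻` for odd `p`, where
`A = A⁺ ⊕ A⁻`); for a complex `w` ALL of `A` (corank `d`), matching the summand `d` of `δ`.
[cite: PollackWeston2011, App. A (arXiv:math/0610694 §8, p0018 L49–54)] -/
def minusPart (w : InfinitePlace K) : AddSubgroup M where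
  carrier := {m | ∀ δ ∈ decompInf w, δ ≠ 1 → δ • m = -m}
  add_mem' := by
    intro a b ha hb δ hδ h1
    rw [smul_add, ha δ hδ h1, hb δ hδ h1, neg_add]
  zero_mem' := by
    intro δ _ _
    rw [smul_zero, neg_zero]
  neg_mem' := by
    intro a ha δ hδ h1
    rw [smul_neg, ha δ hδ h1]

omit [NumberField K] in
/-- Membership in `minusPart`. [cite: PollackWeston2011, App. A (arXiv:math/0610694 §8, p0018 L49–54)] -/
theorem mem_minusPart_iff (w : InfinitePlace K) (m : M) :
    m ∈ minusPart M w ↔ ∀ δ ∈ decompInf w, δ ≠ 1 → δ • m = -m :=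
  Iff.rfl

/-- **`δ(K, V) = Σ_{v complex} d + Σ_{v real} d_v⁻`** (PW p0018 L49–54), read on `A` (`𝒪 = ℤ_p`,
odd `p`): the sum over the archimedean places `w` of `K` of the `ℤ_p`-corank of `minusPart M w`
(`= d` at complex `w`, `= d_w⁻` at real `w`). [cite: PollackWeston2011, App. A (arXiv:math/0610694 §8, p0018 L49–54)] -/
def delta (K : Type) [Field K] [NumberField K] (M : Type) [AddCommGroup M]
    [DistribMulAction (absoluteGaloisGroup K) M] (p : ℕ) : ℕ :=
  ∑ w : InfinitePlace K, zpCorank ↥(minusPart M w) p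

end Invariants

section LocalCorank

variable {p : ℕ} [Fact p.Prime] (κ : ZpExtension K p) {M : Type} [AddCommGroup M]
  [DistribMulAction (absoluteGaloisGroup K) M] [TopologicalSpace M] [DiscreteTopology M]

/-- **`Γ_v^{pⁿ}` pulled back to `D_v`**: the elements `δ ∈ D_v` whose image `κ δ` is a `pⁿ`-th
power in `κ(D_v) = Γ_v ≤ Γ ≅ ℤ_p` — i.e. `Gal(K̄_v/K_{m,w})` for the layer with `[K_{m,w} : K_v] = pⁿ`
when `v` is finitely decomposed (`Γ_v ≅ ℤ_p`, `[Γ_v : Γ_v^{pⁿ}] = pⁿ`). PW p0019 L31: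
"`Gal(K_{∞,𝔓}/K_{n,v})`". [cite: PollackWeston2011, App. A (arXiv:math/0610694 §8, p0019 L31–33)] -/
def decompPow (v : HeightOneSpectrum (𝓞 K)) (n : ℕ) : Subgroup ↥(decomp (K := K) v) :=
  (((decomp (K := K) v).map κ.toContinuousMonoidHom.toMonoidHom).map (powMonoidHom (p ^ n))).comap
    (κ.toContinuousMonoidHom.toMonoidHom.comp (decomp (K := K) v).subtype)

/-- Membership in `decompPow`: `κ δ = (κ δ')^{pⁿ}` for some `δ' ∈ D_v`.
[cite: PollackWeston2011, App. A (arXiv:math/0610694 §8, p0019 L31–33)] -/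
theorem mem_decompPow_iff (v : HeightOneSpectrum (𝓞 K)) (n : ℕ) (δ : ↥(decomp (K := K) v)) :
    δ ∈ decompPow κ v n ↔
      ∃ δ' : absoluteGaloisGroup K, δ' ∈ decomp (K := K) v ∧
        (κ δ') ^ (p ^ n) = κ (δ : absoluteGaloisGroup K) := by
  simp only [decompPow, Subgroup.mem_comap, Subgroup.mem_map, MonoidHom.coe_comp,
    Function.comp_apply, Subgroup.coe_subtype, powMonoidHom_apply, exists_exists_and_eq_and]
  rfl

variable (𝓛 : SelmerStructure κ.kerSubgroup M)

/-- **`(𝓛_𝔓)^{Γ_𝔭^{pⁿ}}`**: the classes of `𝓛_{w₀} = loc v` fixed by `localConj δ` for every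
`δ ∈ decompPow κ v n` — PW p0019 L31: "`𝓛_{v,t} := 𝓛_{𝔓,t}^{Gal(K_{∞,𝔓}/K_{n,v})}`" (untwisted).
[cite: PollackWeston2011, App. A (arXiv:math/0610694 §8, p0019 L31–33)] -/
def locInvariants (v : HeightOneSpectrum (𝓞 K)) (n : ℕ) : AddSubgroup (localH1 κ.kerSubgroup M v) :=
  𝓛.loc v ⊓ ⨅ δ ∈ decompPow κ v n, (localConj κ.kerSubgroup M v δ - AddMonoidHom.id _).ker

/-- Membership in `locInvariants`. [cite: PollackWeston2011, App. A (arXiv:math/0610694 §8, p0019 L31–33)] -/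
theorem mem_locInvariants_iff (v : HeightOneSpectrum (𝓞 K)) (n : ℕ) (x : localH1 κ.kerSubgroup M v) :
    x ∈ locInvariants κ 𝓛 v n ↔
      x ∈ 𝓛.loc v ∧ ∀ δ ∈ decompPow κ v n, localConj κ.kerSubgroup M v δ x = x := by
  simp only [locInvariants, AddSubgroup.mem_inf, AddSubgroup.mem_iInf, AddMonoidHom.mem_ker,
    AddMonoidHom.sub_apply, AddMonoidHom.id_apply, sub_eq_zero]

/-- **`r_𝔭`, "the `Λ`-corank of `𝓛_𝔓`" (PW p0018 L56–59), in invariant-growth form**: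
`HasLocalCorank κ 𝓛 v r` says `corank_{ℤ_p} (𝓛_𝔓)^{Γ_v^{pⁿ}} = r·pⁿ + O(1)` uniformly in `n`
(tree `zpCorank`). For the cofinitely generated `Λ_v = ℤ_p⟦Γ_v⟧`-module `𝓛_𝔓 ≤ H¹(K_{∞,𝔓}, A)`
(`v` finitely decomposed, `Γ_v ≅ ℤ_p`) this is EQUIVALENT to `corank_{Λ_v} 𝓛_𝔓 = r` by the structure
theory of finitely generated `Λ`-modules (`rank_{ℤ_p} Y/ω_n Y = (rank_Λ Y)·pⁿ + O(1)`, Greenberg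
LNM 1716 pp. 61–62), and it is the form in which the proof of A.2 uses `r_𝔭` (p0019 L31–33:
"has `𝒪`-corank at least `r_𝔭 [K_{n,v}:K_𝔭]` and exactly this value for all but finitely many `t`").
PW note `r_𝔭` does not depend on the prime `𝔓 ∣ 𝔭` (L56–58); here `𝔓 = w₀` is the chosen one.
[cite: PollackWeston2011, App. A (arXiv:math/0610694 §8, p0018 L56–59; p0019 L31–33)]
[cite: GreenbergLNM1716, §1 pp. 61–62 (coranks of invariants vs. Λ-rank)] -/
def HasLocalCorank (v : HeightOneSpectrum (𝓞 K)) (r : ℕ) : Prop :=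
  ∃ B : ℕ, ∀ n : ℕ,
    zpCorank ↥(locInvariants κ 𝓛 v n) p ≤ r * p ^ n + B ∧
      r * p ^ n ≤ zpCorank ↥(locInvariants κ 𝓛 v n) p + B

end LocalCorank

/-! ## §6 THE NAMED FACT: Pollack–Weston 2011, Proposition A.2 (= arXiv:math/0610694 Prop. 8.2) -/

/-- **Pollack–Weston, Compositio Math. 147 (2011), Appendix A, Proposition A.2 (= arXiv:math/0610694
§8, Proposition 8.2) — SURJECTIVITY OF THE GLOBAL-TO-LOCAL MAP over a `ℤ_p`-extension; named fact,
statement only, nothing asserted (D-0014).** PRINT (p0018 L61–75): "Assume that: no place of `K`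
lying over `p` splits completely in `K_∞`; `Sel(K_∞, A)` is `Λ`-cotorsion; `H⁰(K_∞, A*)` is finite
where `A* = Hom(T, μ_{p^∞})`; `Σ_{𝔭∣p} r_𝔭 = [K:ℚ]d − δ(K, V)`. Then the global-to-local map
`H¹(K_∞, A) →γ ∏_{v∈Σ} ℋ_v(K_∞, A)` is surjective." Setting (p0018 L3–11, L43–59): `K` a number field,
`F/ℚ_p` finite with integers `𝒪`, `V` a `d`-dimensional `F`-representation of `G_K` ramified at
finitely many primes, `T` a lattice, `A = V/T`; `Σ ⊇ {v ∣ p} ∪ ∞ ∪ Ram(V)` finite; a Selmer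
structure `(𝓛_w)_{w∈Σ_{K_∞}}`, `σ𝓛_w = 𝓛_{σw}`; `Sel(K_∞, A) = ker(H¹(K_Σ/K_∞, A) → ∏_w H¹(K_{∞,w},
A)/𝓛_w)`; `ℋ_v(K_∞, A) = lim_m ∏_{w∈σ_{m,v}} H¹(K_{m,w}, A)/𝓛_w`; `δ(K, V) = Σ_{complex} d +
Σ_{real} d_v⁻`; `r_𝔭` = the `Λ`-corank of `𝓛_𝔓`, `𝔓 ∣ 𝔭`; `p` odd (§1 p0004 L3; used at p0019 L43
"as `p ≠ 2`"). Proof = [GV00] Prop. (2.1) with Greenberg's twisting trick (pp0018–0019), NOT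
reproduced. TRANSCRIPTION (module docstring, every identification justified there): `p` an odd
prime; `κ` ANY `ℤ_p`-extension of the number field `K` with topological generator `γ`; `A = M` a
discrete `Γ_K`-module, `p`-primary, divisible, with open stabilisers and `M[p]` finite
(`A ≅ (ℚ_p/ℤ_p)^d`, `d = zpCorank M p`; `𝒪 = ℤ_p` reading — lossless); `Σ ∖ ∞ = S` a finite set of
finite places containing every `v ∣ p` and every place at which `M` is ramified (`I_v` acts
trivially for `v ∉ S`); **scope: every `v ∈ S` finitely decomposed in `K_∞`** (`numPlacesAbove κ v ≠ 0`
— this is hypothesis (1) at `v ∣ p` and PW Lemma 3.2's split case at `v ∤ p`); `𝓛` a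
`SelmerStructure` (`D_v`-stable local conditions at the chosen places, transported by `conj_σ`);
(2) = a dual datum `X` of `𝓛.selmer p S` (`IsDualData`, w.r.t. `γ`) which is finitely generated and
`Λ`-torsion; (3) = every `Gal(K̄/K_∞)`-equivariant homomorphism `M → ℚ_p/ℤ_p(1)` (`QpModZp p`,
action through `GaloisRep.cyclotomicCharacter K p`) is zero (⟺ `H⁰(K_∞, A*)` finite, for divisible
`A`); `r v` (`v ∈ S`, `v ∣ p`) with `HasLocalCorank κ 𝓛 v (r v)` (= "`Λ`-corank of `𝓛_𝔓` is `r_𝔭`");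
(4) = `Σ_{v∈S, v∣p} r v + delta K M p = [K:ℚ] · d`. CONCLUSION: `𝓛.globalToLocal κ γ S :
H¹(K_Σ/K_∞, A) → ∏_{v∈S} ℋ_v(K_∞, A)` is SURJECTIVE (`ℋ_v = calH κ 𝓛 v`, the finite product over the
places of `K_∞` above `v`). Nothing printed is strengthened: (1) is implied by the scope hypothesis;
the archimedean factors of the target vanish for odd `p`; the source is `H¹(K_Σ/K_∞, A)` as in the
proof (p0019 L13–16, L50 "`coker(γ_t) = coker(γ)`"). Consumers: Greenberg–Vatsal Cor. (2.3)-type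
exact sequences `0 → Sel → Sel^{S₀} → ∏_{w∈S₀} ℋ_w → 0` (CGLS Prop. 1.2.5 / Thm. 1.5.1, KY Prop. 1.2.5 /
Rem. 1.4.2), in particular the derivation of `KellerYin2024.prop125_residualPair_unrSelmer_corank_ge`.
-- TODO(general form): PW allow places `v ∤ p` of `Σ` splitting completely in `K_∞`
-- (`ℋ_v = lim_m ∏_{σ_{m,v}} H¹(K_v, A)/𝓛 ≅ H¹(K_v, A)/𝓛 ⊗ Λ^∨`, induced finite-level structures) and
-- coefficients `𝒪 ⊋ ℤ_p` with `𝒪`-submodules `𝓛_w`; only finitely decomposed `Σ` and the `ℤ_p`-reading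
-- are typed.
[cite: PollackWeston2011, App. A Prop. A.2 (= arXiv:math/0610694 §8 Prop. 8.2; store paper:arxiv-math_0610694 p0018 L61–75), setting p0018 L3–11 and L43–59, proof pp0018 L77 – p0019 L52, Lemma 3.2 (p0007 L56–60), §1 p0004 L3 (odd p)]
[cite: GreenbergVatsal2000, §2 Prop. (2.1) (p. 17) (the K = ℚ model of the statement and proof)] -/
def propA2_globalToLocal_surjective : Prop :=
  ∀ (K : Type) [Field K] [NumberField K] (p : ℕ) [Fact p.Prime], p ≠ 2 →
  ∀ (κ : ZpExtension K p) (γ : absoluteGaloisGroup K), κ.IsTopGenerator γ →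
  ∀ (M : Type) [AddCommGroup M] [DistribMulAction (absoluteGaloisGroup K) M]
    [TopologicalSpace M] [DiscreteTopology M],
    (∀ m : M, ∃ k : ℕ, p ^ k • m = 0) →
    (∀ m : M, ∃ m' : M, p • m' = m) →
    (∀ m : M, IsOpen (MulAction.stabilizer (absoluteGaloisGroup K) m : Set (absoluteGaloisGroup K))) →
    Finite ↥(AddSubgroup.torsionBy M (p : ℤ)) →
  ∀ (S : Finset (HeightOneSpectrum (𝓞 K))),
    (∀ v : HeightOneSpectrum (𝓞 K), ((p : ℕ) : 𝓞 K) ∈ v.asIdeal → v ∈ S) →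
    (∀ v : HeightOneSpectrum (𝓞 K), v ∉ S → ∀ δ ∈ inertia (K := K) v, ∀ m : M, δ • m = m) →
    (∀ v ∈ S, numPlacesAbove κ v ≠ 0) →
  ∀ (𝓛 : SelmerStructure κ.kerSubgroup M)
    (X : Type) [AddCommGroup X] [Module (IwasawaAlgebra p) X]
    (toDual : X →+ (↥(𝓛.selmer p S) →+ AddCircle (1 : ℚ))),
    𝓛.IsDualData κ γ S toDual → Module.Finite (IwasawaAlgebra p) X →
    Module.IsTorsion (IwasawaAlgebra p) X →
    (∀ f : M →+ QpModZp p,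
      (∀ h : absoluteGaloisGroup K, h ∈ κ.kerSubgroup →
        ∀ m : M, f (h • m) = ((GaloisRep.cyclotomicCharacter K p h : ℤ_[p]ˣ) : ℤ_[p]) • f m) →
      f = 0) →
  ∀ (r : HeightOneSpectrum (𝓞 K) → ℕ),
    (∀ v ∈ S, ((p : ℕ) : 𝓞 K) ∈ v.asIdeal → HasLocalCorank κ 𝓛 v (r v)) →
    (∑ v ∈ S.filter (fun v ↦ ((p : ℕ) : 𝓞 K) ∈ v.asIdeal), r v) + delta K M p =
      Module.finrank ℚ K * zpCorank M p →
    Function.Surjective (𝓛.globalToLocal κ γ S)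

/-! ## §7 The defining exact sequence `0 → Sel(K_∞, A) → H¹(K_Σ/K_∞, A) →γ ∏_{v∈Σ} ℋ_v(K_∞, A)`:
## `ker γ = Sel(K_∞, A)` (p0018 L10–11, p0019 L13–16; appended 2026-08-28, unit `bsd-eis-x1-ty1` g3) -/

section Kernel

variable {p : ℕ} [Fact p.Prime] (κ : ZpExtension K p)

/-- **`Γ_K = ⋃_{n < [Γ:Γ_v]} D_v γⁿ H` at a finitely decomposed `v`**: if `numPlacesAbove κ v ≠ 0`
(i.e. `Γ_v = κ(D_v)` has finite index in `Γ ≅ ℤ_p`) and `γ` is a topological generator, every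
`σ ∈ Γ_K` is `δ · γⁿ · h` with `δ ∈ D_v`, `n < numPlacesAbove κ v`, `h ∈ H = Gal(K̄/K_∞)` — the
`[Γ:Γ_v]` translates `γ^{-n} w₀` exhaust the places of `K_∞` above `v` (PW p0018 L43: "`σ_{m,v}`
the set of places of `K_m` lying over `v`"). Group theory of `ℤ_p`: `N = [Γ:Γ_v]` kills `Γ/Γ_v`, so
`N ℤ_p = p^{v_p(N)} ℤ_p ≤ Γ_v`, and `κ σ ≡ appr (mod p^{v_p(N)})`. [cite: Washington1997, §13.1]
[cite: PollackWeston2011, App. A (arXiv:math/0610694 §8, p0018 L43–47)] -/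
theorem exists_eq_decomp_mul_pow_mul {γ : absoluteGaloisGroup K} (hγ : κ.IsTopGenerator γ)
    {v : HeightOneSpectrum (𝓞 K)} (hv : numPlacesAbove κ v ≠ 0) (σ : absoluteGaloisGroup K) :
    ∃ n < numPlacesAbove κ v, ∃ δ ∈ decomp (K := K) v, ∃ h ∈ κ.kerSubgroup, σ = δ * γ ^ n * h := by
  set Γv : Subgroup (Multiplicative ℤ_[p]) :=
    (decomp (K := K) v).map κ.toContinuousMonoidHom.toMonoidHom with hΓv
  have hN : numPlacesAbove κ v = Γv.index := numPlacesAbove_eq κ v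
  have hp : (p : ℕ).Prime := Fact.out
  obtain ⟨a, u, hu, hNu⟩ := Nat.exists_eq_pow_mul_and_not_dvd hv p hp.ne_one
  -- every `N`-th power lies in `Γ_v`
  have hpow : ∀ y : ℤ_[p], Multiplicative.ofAdd ((numPlacesAbove κ v : ℤ_[p]) * y) ∈ Γv := by
    intro y
    have h := Subgroup.pow_index_mem Γv (Multiplicative.ofAdd y)
    rwa [← hN, ← ofAdd_nsmul, nsmul_eq_mul] at h
  -- `u` is a `p`-adic unit
  have hunit : IsUnit (u : ℤ_[p]) := by
    rw [PadicInt.isUnit_iff]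
    refine le_antisymm (PadicInt.norm_le_one _) (not_lt.1 fun hlt ↦ hu ?_)
    rw [← Int.cast_natCast, PadicInt.norm_int_lt_one_iff_dvd] at hlt
    exact_mod_cast hlt
  obtain ⟨w, hw⟩ := hunit.exists_right_inv
  have hu0 : u ≠ 0 := fun h0 ↦ hv (by rw [hNu, h0, mul_zero])
  set x : ℤ_[p] := (κ σ).toAdd with hx
  refine ⟨x.appr a, ?_, ?_⟩
  · calc x.appr a < p ^ a := PadicInt.appr_lt x a
      _ ≤ p ^ a * u := Nat.le_mul_of_pos_right _ (Nat.pos_of_ne_zero hu0)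
      _ = numPlacesAbove κ v := hNu.symm
  · obtain ⟨z, hz⟩ := Ideal.mem_span_singleton'.1 (PadicInt.appr_spec a x)
    have hmem : Multiplicative.ofAdd (x - (x.appr a : ℤ_[p])) ∈ Γv := by
      have hcalc : x - (x.appr a : ℤ_[p]) = (numPlacesAbove κ v : ℤ_[p]) * (w * z) := by
        calc x - (x.appr a : ℤ_[p]) = z * (p : ℤ_[p]) ^ a := hz.symm
          _ = z * (p : ℤ_[p]) ^ a * ((u : ℤ_[p]) * w) := by rw [hw, mul_one]
          _ = ((p ^ a * u : ℕ) : ℤ_[p]) * (w * z) := by push_cast; ring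
          _ = (numPlacesAbove κ v : ℤ_[p]) * (w * z) := by rw [hNu]
      rw [hcalc]
      exact hpow _
    obtain ⟨δ, hδ, hκδ⟩ := Subgroup.mem_map.1 hmem
    change κ δ = _ at hκδ
    refine ⟨δ, hδ, (δ * γ ^ x.appr a)⁻¹ * σ, ?_, by rw [mul_inv_cancel_left]⟩
    rw [ZpExtension.mem_kerSubgroup, map_mul, map_inv, map_mul, map_pow, hγ, inv_mul_eq_one, hκδ,
      ← ofAdd_nsmul, nsmul_eq_mul, mul_one, ← ofAdd_add, sub_add_cancel, hx, ofAdd_toAdd]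

variable {M : Type} [AddCommGroup M] [DistribMulAction (absoluteGaloisGroup K) M]
  [TopologicalSpace M] [DiscreteTopology M] (𝓛 : SelmerStructure κ.kerSubgroup M)

namespace SelmerStructure

/-- **The condition at `v` is read on `[Γ:Γ_v]` conjugates**: for `v` finitely decomposed in `K_∞`
and `γ` a topological generator, `c` satisfies `𝓛` at EVERY place of `K_∞` above `v` (`condAt v`:
`res_{w₀}(conj_σ c) ∈ 𝓛_{w₀}` for all `σ ∈ Γ_K`) iff `res_{w₀}(conj_{γⁿ} c) ∈ 𝓛_{w₀}` for the
`n < numPlacesAbove κ v` — by `exists_eq_decomp_mul_pow_mul` (`σ = δ γⁿ h`), the inner action of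
`H` being trivial (`conjH1_of_mem`) and `res_{w₀} ∘ conj_δ = conj_δ ∘ res_{w₀}` (`locRes_conjH1`) with
the `D_v`-stability of `𝓛_{w₀}` ("`σ𝓛_w = 𝓛_{σw}`"). [cite: PollackWeston2011, App. A (arXiv:math/0610694 §8, p0018 L7–11, L43–47)] -/
theorem mem_condAt_iff_forall_lt {γ : absoluteGaloisGroup K} (hγ : κ.IsTopGenerator γ)
    {v : HeightOneSpectrum (𝓞 K)} (hv : numPlacesAbove κ v ≠ 0) (c : subgroupH1 κ.kerSubgroup M) :
    c ∈ 𝓛.condAt v ↔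
      ∀ n < numPlacesAbove κ v,
        locRes κ.kerSubgroup M v (conjH1 κ.kerSubgroup M (γ ^ n) c) ∈ 𝓛.loc v := by
  refine ⟨fun hc n _ ↦ (𝓛.mem_condAt_iff v c).1 hc _, fun hc ↦ (𝓛.mem_condAt_iff v c).2 fun σ ↦ ?_⟩
  obtain ⟨n, hn, δ, hδ, h, hh, rfl⟩ := exists_eq_decomp_mul_pow_mul κ hγ hv σ
  rw [conjH1_mul_holds κ.kerSubgroup M (δ * γ ^ n) h, AddMonoidHom.comp_apply,
    conjH1_of_mem_holds κ.kerSubgroup M hh, AddMonoidHom.id_apply,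
    conjH1_mul_holds κ.kerSubgroup M δ (γ ^ n), AddMonoidHom.comp_apply,
    ← AddMonoidHom.comp_apply (locRes κ.kerSubgroup M v) (conjH1 κ.kerSubgroup M δ),
    locRes_conjH1 κ.kerSubgroup M v ⟨δ, hδ⟩, AddMonoidHom.comp_apply]
  exact 𝓛.localConj_mem v ⟨δ, hδ⟩ (hc n hn)

/-- **`γ_v(c) = 0 ⟺ c` satisfies `𝓛` at every place above `v`** (`v` finitely decomposed, `γ` a
topological generator): the kernel of the `v`-component `toCalH` of PW's global-to-local map is
`condAt v`. [cite: PollackWeston2011, App. A (arXiv:math/0610694 §8, p0018 L10–11, L43–47)] -/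
theorem toCalH_eq_zero_iff_mem_condAt {γ : absoluteGaloisGroup K} (hγ : κ.IsTopGenerator γ)
    {v : HeightOneSpectrum (𝓞 K)} (hv : numPlacesAbove κ v ≠ 0) (c : subgroupH1 κ.kerSubgroup M) :
    𝓛.toCalH κ γ v c = 0 ↔ c ∈ 𝓛.condAt v := by
  rw [𝓛.mem_condAt_iff_forall_lt κ hγ hv c, funext_iff]
  constructor
  · intro h n hn
    have h' := h ⟨n, hn⟩
    rwa [toCalH_apply, Pi.zero_apply, QuotientAddGroup.eq_zero_iff] at h'
  · intro h i
    rw [toCalH_apply, Pi.zero_apply, QuotientAddGroup.eq_zero_iff]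
    exact h i i.2

/-- **PW's defining exact sequence `0 → Sel(K_∞, A) → H¹(K_Σ/K_∞, A) →γ ∏_{v∈Σ} ℋ_v(K_∞, A)`**
(p0018 L10–11 "`Sel(L, A) = ker(…)`"; p0019 L13–16; Prop. 5.1 "the defining sequences"), for every
`v ∈ S` finitely decomposed in `K_∞` and `γ` a topological generator: a class of `H¹(K_Σ/K_∞, A)`
dies under `γ` iff it lies in `Sel(K_∞, A)`.
[cite: PollackWeston2011, App. A (arXiv:math/0610694 §8, p0018 L10–11, L70–73; p0019 L13–16) and Prop. 5.1 (p0013)] -/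
theorem globalToLocal_eq_zero_iff_mem_selmer {γ : absoluteGaloisGroup K} (hγ : κ.IsTopGenerator γ)
    (S : Finset (HeightOneSpectrum (𝓞 K))) (hS : ∀ v ∈ S, numPlacesAbove κ v ≠ 0)
    (c : ↥(unramifiedOutside κ.kerSubgroup M p (↑S : Set (HeightOneSpectrum (𝓞 K))))) :
    𝓛.globalToLocal κ γ S c = 0 ↔ (c : subgroupH1 κ.kerSubgroup M) ∈ 𝓛.selmer p S := by
  rw [𝓛.mem_selmer_iff p S, funext_iff]
  constructor
  · intro h
    refine ⟨c.2, fun v hv ↦ ?_⟩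
    have h' := h ⟨v, hv⟩
    rw [globalToLocal_apply, Pi.zero_apply] at h'
    exact (𝓛.toCalH_eq_zero_iff_mem_condAt κ hγ (hS v hv) _).1 h'
  · rintro ⟨-, h⟩ v
    rw [globalToLocal_apply, Pi.zero_apply]
    exact (𝓛.toCalH_eq_zero_iff_mem_condAt κ hγ (hS v v.2) _).2 (h v v.2)

/-- **`ker γ = Sel(K_∞, A)`** as subgroups of `H¹(K_Σ/K_∞, A)` (every `v ∈ S` finitely decomposed,
`γ` a topological generator) — so the SURJECTIVITY of Prop. A.2 makes
`0 → Sel(K_∞, A) → H¹(K_Σ/K_∞, A) →γ ∏_{v∈Σ} ℋ_v(K_∞, A) → 0` exact (PW Prop. 5.1).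
[cite: PollackWeston2011, App. A (arXiv:math/0610694 §8, p0018 L10–11; p0019 L13–16) and Prop. 5.1 (p0013)] -/
theorem ker_globalToLocal_eq {γ : absoluteGaloisGroup K} (hγ : κ.IsTopGenerator γ)
    (S : Finset (HeightOneSpectrum (𝓞 K))) (hS : ∀ v ∈ S, numPlacesAbove κ v ≠ 0) :
    (𝓛.globalToLocal κ γ S).ker =
      (𝓛.selmer p S).addSubgroupOf
        (unramifiedOutside κ.kerSubgroup M p (↑S : Set (HeightOneSpectrum (𝓞 K)))) := by
  ext c
  rw [AddMonoidHom.mem_ker, AddSubgroup.mem_addSubgroupOf]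
  exact 𝓛.globalToLocal_eq_zero_iff_mem_selmer κ hγ S hS c

end SelmerStructure

end Kernel

/-! ## §8 The non-primitive exact sequence `0 → Sel(K_∞, A) → Sel^{Σ₀}(K_∞, A) → ∏_{v∈Σ₀} ℋ_v(K_∞, A) → 0`
## (Greenberg–Vatsal Cor. (2.3); Pollack–Weston Prop. 5.1 / Cor. 5.2 — the form in which Prop. A.2 is
## consumed; appended 2026-08-28, unit `bsd-eis-x1-ty1` g4)

PRINT. [GV00] §2 (arXiv:math/9906215 chunk p0043 L105–118): "Proposition (2.1), together with the fact
that `ℋ_ℓ(ℚ_∞)` is `Λ`-cotorsion for `ℓ ≠ p`, immediately gives the following result: **Corollary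
(2.3)** With assumptions as in (2.1), we have `S^{Σ₀}_A(ℚ_∞)/S_A(ℚ_∞) ≅ ∏_{ℓ∈Σ₀} ℋ_ℓ(ℚ_∞)`", where
`S^{Σ₀}_A` is the "non-primitive" Selmer group obtained by OMITTING the local conditions at the places
of `Σ₀ ⊆ Σ ∖ {p, ∞}` (GV p. 20). [PW11] Cor. 5.2 (arXiv p0013 L30–34): "the sequence
`0 → Sel → 𝔖el → ∏_{ℓ∣N⁻} ℋ_ℓ^un → 0` is an exact sequence of cotorsion `Λ`-modules … This is immediate
from Proposition 5.1 [= the surjectivity of Prop. A.2 for the defining sequences] and Lemma 3.4."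
MECHANISM (the one-line proofs of both): if `γ : H¹(K_Σ/K_∞, A) → ∏_{v∈Σ} ℋ_v` is onto, then so is its
restriction `Sel^{Σ₀} → ∏_{v∈Σ₀} ℋ_v` (zero-extend a tuple over `Σ₀` to `Σ`, lift it through `γ`; the
lift satisfies the conditions off `Σ₀` because its components there vanish, `ker γ_v = condAt v`, §7),
and the kernel of that restriction is `Sel` (§7 again). Typed here for an arbitrary Selmer structure
`𝓛` over `K_∞ = K̄^{ker κ}` and finite sets `S₀ ⊆ S` of places finitely decomposed in `K_∞`; the
surjectivity of `γ` is a HYPOTHESIS (it is the conclusion of `propA2_globalToLocal_surjective`), so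
nothing is asserted and no fact is introduced. -/

section Relaxed

variable {H : Subgroup (absoluteGaloisGroup K)} [H.Normal] {M : Type} [AddCommGroup M]
  [DistribMulAction (absoluteGaloisGroup K) M] [TopologicalSpace M] [DiscreteTopology M]

namespace SelmerStructure

variable (𝓛 : SelmerStructure H M)

/-- **The Selmer structure RELAXED at `S₀`** ("non-primitive", GV p. 20: "we define `S^{Σ₀}_A` by
omitting the local conditions at the primes `ℓ ∈ Σ₀`"; KY/CGLS `𝓕^{S₀}`): no condition (`𝓛_w = H¹(L_w,
A)`, i.e. `⊤`) at the places of `S₀`, the conditions of `𝓛` elsewhere. Its Selmer group is PW's /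
GV's `Sel^{Σ₀}(K_∞, A)`. [cite: GreenbergVatsal2000, §2 p. 20 and Cor. (2.3) (arXiv:math/9906215 chunk p0043 L105–118)]
[cite: PollackWeston2011, Cor. 5.2 (arXiv:math/0610694 p0013 L30–34)] -/
def relax (S₀ : Set (HeightOneSpectrum (𝓞 K))) : SelmerStructure H M where
  loc v := if v ∈ S₀ then ⊤ else 𝓛.loc v
  localConj_mem := by
    intro v δ x hx
    by_cases hv : v ∈ S₀
    · rw [if_pos hv]
      exact AddSubgroup.mem_top _
    · rw [if_neg hv] at hx ⊢
      exact 𝓛.localConj_mem v δ hx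

/-- At `v ∈ S₀` the relaxed condition is everything. [cite: GreenbergVatsal2000, §2 p. 20] -/
theorem relax_loc_of_mem {S₀ : Set (HeightOneSpectrum (𝓞 K))} {v : HeightOneSpectrum (𝓞 K)}
    (hv : v ∈ S₀) : (𝓛.relax S₀).loc v = ⊤ :=
  if_pos hv

/-- Off `S₀` the relaxed condition is the condition of `𝓛`. [cite: GreenbergVatsal2000, §2 p. 20] -/
theorem relax_loc_of_not_mem {S₀ : Set (HeightOneSpectrum (𝓞 K))} {v : HeightOneSpectrum (𝓞 K)}
    (hv : v ∉ S₀) : (𝓛.relax S₀).loc v = 𝓛.loc v :=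
  if_neg hv

/-- At `v ∈ S₀` the relaxed structure imposes nothing at any place above `v` (`condAt v = ⊤`).
[cite: GreenbergVatsal2000, §2 p. 20] -/
theorem condAt_relax_of_mem {S₀ : Set (HeightOneSpectrum (𝓞 K))} {v : HeightOneSpectrum (𝓞 K)}
    (hv : v ∈ S₀) : (𝓛.relax S₀).condAt v = ⊤ := by
  refine eq_top_iff.2 fun c _ ↦ ((𝓛.relax S₀).mem_condAt_iff v c).2 fun σ ↦ ?_
  rw [𝓛.relax_loc_of_mem hv]
  exact AddSubgroup.mem_top _

/-- Off `S₀` the relaxed structure imposes the condition of `𝓛` above `v` (`condAt v` unchanged).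
[cite: GreenbergVatsal2000, §2 p. 20] -/
theorem condAt_relax_of_not_mem {S₀ : Set (HeightOneSpectrum (𝓞 K))} {v : HeightOneSpectrum (𝓞 K)}
    (hv : v ∉ S₀) : (𝓛.relax S₀).condAt v = 𝓛.condAt v := by
  ext c
  rw [mem_condAt_iff, mem_condAt_iff, 𝓛.relax_loc_of_not_mem hv]

variable (p : ℕ) (S : Finset (HeightOneSpectrum (𝓞 K)))

/-- **Membership in `Sel^{Σ₀}(L, A)`**: unramified outside `S ∪ {v ∣ p}` and the conditions of `𝓛`
above every `v ∈ S ∖ S₀` — GV's "omitting the local conditions at `Σ₀`".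
[cite: GreenbergVatsal2000, §2 p. 20] [cite: PollackWeston2011, App. A (arXiv:math/0610694 §8, p0018 L10–11)] -/
theorem mem_selmer_relax_iff (S₀ : Set (HeightOneSpectrum (𝓞 K))) (c : subgroupH1 H M) :
    c ∈ (𝓛.relax S₀).selmer p S ↔
      c ∈ unramifiedOutside H M p (↑S : Set (HeightOneSpectrum (𝓞 K))) ∧
        ∀ v ∈ S, v ∉ S₀ → c ∈ 𝓛.condAt v := by
  rw [mem_selmer_iff]
  refine and_congr_right fun _ ↦ forall₂_congr fun v _ ↦ ?_
  by_cases hv : v ∈ S₀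
  · rw [𝓛.condAt_relax_of_mem hv]
    exact ⟨fun _ h ↦ (h hv).elim, fun _ ↦ AddSubgroup.mem_top _⟩
  · rw [𝓛.condAt_relax_of_not_mem hv]
    exact ⟨fun h _ ↦ h, fun h ↦ h hv⟩

/-- `Sel(L, A) ≤ Sel^{Σ₀}(L, A)` (fewer conditions). [cite: GreenbergVatsal2000, §2 p. 20] -/
theorem selmer_le_selmer_relax (S₀ : Set (HeightOneSpectrum (𝓞 K))) :
    𝓛.selmer p S ≤ (𝓛.relax S₀).selmer p S := by
  intro c hc
  rw [mem_selmer_iff] at hc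
  exact (𝓛.mem_selmer_relax_iff p S S₀ c).2 ⟨hc.1, fun v hv _ ↦ hc.2 v hv⟩

end SelmerStructure

end Relaxed

section NonPrimitive

variable {p : ℕ} [Fact p.Prime] (κ : ZpExtension K p) {M : Type} [AddCommGroup M]
  [DistribMulAction (absoluteGaloisGroup K) M] [TopologicalSpace M] [DiscreteTopology M]
  (𝓛 : SelmerStructure κ.kerSubgroup M)

namespace SelmerStructure

/-- **Greenberg–Vatsal's map `Sel^{Σ₀}(K_∞, A) → ∏_{v∈Σ₀} ℋ_v(K_∞, A)`** (the restriction of PW's `γ`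
to the classes satisfying `𝓛` off `S₀`, read only in the `S₀`-components): `c ↦ (γ_w c)_{w∈S₀}`,
`γ_w = toCalH` of the UNRELAXED structure `𝓛` (so the target is `∏_{w∈S₀} ℋ_w` with the factors
`H¹(K_{∞,η}, A)/𝓛_η`, `η ∣ w`). [cite: GreenbergVatsal2000, §2 Cor. (2.3) (arXiv:math/9906215 chunk p0043 L105–118)]
[cite: PollackWeston2011, Cor. 5.2 (arXiv:math/0610694 p0013 L30–34)] -/
def relaxToCalH (γ : absoluteGaloisGroup K) (S S₀ : Finset (HeightOneSpectrum (𝓞 K))) :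
    ↥((𝓛.relax (↑S₀ : Set (HeightOneSpectrum (𝓞 K)))).selmer p S) →+
      ((w : ↥S₀) → calH κ 𝓛 (w : HeightOneSpectrum (𝓞 K))) :=
  (AddMonoidHom.pi fun w : ↥S₀ ↦ 𝓛.toCalH κ γ (w : HeightOneSpectrum (𝓞 K))).comp
    ((𝓛.relax (↑S₀ : Set (HeightOneSpectrum (𝓞 K)))).selmer p S).subtype

/-- Unfolding `relaxToCalH`. [cite: GreenbergVatsal2000, §2 Cor. (2.3)] -/
@[simp]
theorem relaxToCalH_apply (γ : absoluteGaloisGroup K) (S S₀ : Finset (HeightOneSpectrum (𝓞 K)))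
    (c : ↥((𝓛.relax (↑S₀ : Set (HeightOneSpectrum (𝓞 K)))).selmer p S)) (w : ↥S₀) :
    𝓛.relaxToCalH κ γ S S₀ c w = 𝓛.toCalH κ γ (w : HeightOneSpectrum (𝓞 K)) c :=
  rfl

/-- **The kernel of `Sel^{Σ₀} → ∏_{v∈Σ₀} ℋ_v` is `Sel`**: a class of `Sel^{Σ₀}(K_∞, A)` dies in every
`ℋ_w`, `w ∈ S₀`, iff it lies in `Sel(K_∞, A)` (`S₀ ⊆ S`, every `w ∈ S₀` finitely decomposed, `γ` a
topological generator; `ker γ_w = condAt w`, §7) — the left half of GV Cor. (2.3) / PW Cor. 5.2.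
[cite: GreenbergVatsal2000, §2 Cor. (2.3) (arXiv:math/9906215 chunk p0043 L105–118)]
[cite: PollackWeston2011, Prop. 5.1 and Cor. 5.2 (arXiv:math/0610694 p0013 L8–34)] -/
theorem relaxToCalH_eq_zero_iff {γ : absoluteGaloisGroup K} (hγ : κ.IsTopGenerator γ)
    {S S₀ : Finset (HeightOneSpectrum (𝓞 K))} (hS₀ : ∀ w ∈ S₀, numPlacesAbove κ w ≠ 0)
    (hS₀S : S₀ ⊆ S) (c : ↥((𝓛.relax (↑S₀ : Set (HeightOneSpectrum (𝓞 K)))).selmer p S)) :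
    𝓛.relaxToCalH κ γ S S₀ c = 0 ↔ (c : subgroupH1 κ.kerSubgroup M) ∈ 𝓛.selmer p S := by
  have hc := (𝓛.mem_selmer_relax_iff p S _ (c : subgroupH1 κ.kerSubgroup M)).1 c.2
  rw [funext_iff, 𝓛.mem_selmer_iff p S]
  constructor
  · intro h
    refine ⟨hc.1, fun v hv ↦ ?_⟩
    by_cases hv₀ : v ∈ S₀
    · have h' := h ⟨v, hv₀⟩
      rw [relaxToCalH_apply, Pi.zero_apply] at h'
      exact (𝓛.toCalH_eq_zero_iff_mem_condAt κ hγ (hS₀ v hv₀) _).1 h'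
    · exact hc.2 v hv hv₀
  · rintro ⟨-, h⟩ w
    rw [relaxToCalH_apply, Pi.zero_apply]
    exact 𝓛.toCalH_eq_zero_of_mem_condAt κ γ _ (h w (hS₀S w.2))

/-- `ker (Sel^{Σ₀} → ∏_{v∈Σ₀} ℋ_v) = Sel` as a subgroup of `Sel^{Σ₀}` (bundled form of
`relaxToCalH_eq_zero_iff`). [cite: GreenbergVatsal2000, §2 Cor. (2.3) (arXiv:math/9906215 chunk p0043 L105–118)]
[cite: PollackWeston2011, Cor. 5.2 (arXiv:math/0610694 p0013 L30–34)] -/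
theorem ker_relaxToCalH_eq {γ : absoluteGaloisGroup K} (hγ : κ.IsTopGenerator γ)
    {S S₀ : Finset (HeightOneSpectrum (𝓞 K))} (hS₀ : ∀ w ∈ S₀, numPlacesAbove κ w ≠ 0)
    (hS₀S : S₀ ⊆ S) :
    (𝓛.relaxToCalH κ γ S S₀).ker =
      (𝓛.selmer p S).addSubgroupOf ((𝓛.relax (↑S₀ : Set (HeightOneSpectrum (𝓞 K)))).selmer p S) := by
  ext c
  rw [AddMonoidHom.mem_ker, AddSubgroup.mem_addSubgroupOf]
  exact 𝓛.relaxToCalH_eq_zero_iff κ hγ hS₀ hS₀S c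

/-- **`Sel^{Σ₀}(K_∞, A) → ∏_{v∈Σ₀} ℋ_v(K_∞, A)` is SURJECTIVE as soon as PW's `γ` is** (the conclusion
of Prop. A.2, here a hypothesis): zero-extend a tuple over `S₀` to `S`, lift it through `γ` to
`c ∈ H¹(K_Σ/K_∞, A)`; at `v ∈ S ∖ S₀` the component `γ_v c` vanishes, so `c` satisfies `𝓛` above `v`
(`toCalH_eq_zero_iff_mem_condAt`), i.e. `c ∈ Sel^{Σ₀}` — the right half of GV Cor. (2.3) / PW Cor. 5.2
("immediately gives" / "immediate from Proposition 5.1"). Every `v ∈ S` finitely decomposed, `γ` a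
topological generator. [cite: GreenbergVatsal2000, §2 Cor. (2.3) (arXiv:math/9906215 chunk p0043 L105–118)]
[cite: PollackWeston2011, Prop. 5.1 and Cor. 5.2 (arXiv:math/0610694 p0013 L8–34), App. A Prop. A.2] -/
theorem relaxToCalH_surjective_of_globalToLocal_surjective {γ : absoluteGaloisGroup K}
    (hγ : κ.IsTopGenerator γ) {S S₀ : Finset (HeightOneSpectrum (𝓞 K))} (hS₀S : S₀ ⊆ S)
    (hS : ∀ v ∈ S, numPlacesAbove κ v ≠ 0)
    (hsurj : Function.Surjective (𝓛.globalToLocal κ γ S)) :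
    Function.Surjective (𝓛.relaxToCalH κ γ S S₀) := by
  intro y
  -- the zero-extension of `y` to a tuple over `S`, and a lift of it through `γ`
  set Y : (v : ↥S) → calH κ 𝓛 (v : HeightOneSpectrum (𝓞 K)) := fun v ↦
    if h : (v : HeightOneSpectrum (𝓞 K)) ∈ S₀ then y ⟨v, h⟩ else 0
  have hY₀ : ∀ v : ↥S, (v : HeightOneSpectrum (𝓞 K)) ∉ S₀ → Y v = 0 := fun v hv ↦ dif_neg hv
  have hY₁ : ∀ w : ↥S₀, Y ⟨w, hS₀S w.2⟩ = y w := fun w ↦ dif_pos w.2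
  obtain ⟨c, hc⟩ := hsurj Y
  have hcY : ∀ v : ↥S, 𝓛.toCalH κ γ (v : HeightOneSpectrum (𝓞 K)) c = Y v := fun v ↦ congrFun hc v
  refine ⟨⟨(c : subgroupH1 κ.kerSubgroup M), ?_⟩, funext fun w ↦ ?_⟩
  · rw [mem_selmer_relax_iff]
    exact ⟨c.2, fun v hv hv₀ ↦ (𝓛.toCalH_eq_zero_iff_mem_condAt κ hγ (hS v hv) _).1
      ((hcY ⟨v, hv⟩).trans (hY₀ ⟨v, hv⟩ hv₀))⟩
  · rw [relaxToCalH_apply]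
    exact (hcY ⟨w, hS₀S w.2⟩).trans (hY₁ w)

/-- **Greenberg–Vatsal, Invent. Math. 142 (2000), §2 Corollary (2.3) / Pollack–Weston Cor. 5.2, for a
general Selmer structure over `K_∞`: `Sel^{Σ₀}(K_∞, A)/Sel(K_∞, A) ≃ ∏_{v∈Σ₀} ℋ_v(K_∞, A)`**, GRANTED the
surjectivity of PW's global-to-local map `γ` over `S ⊇ S₀` (= the conclusion of Prop. A.2,
`propA2_globalToLocal_surjective`; GV: "with assumptions as in (2.1)") — the first isomorphism theorem
for `relaxToCalH` (`ker = Sel`, onto). Every `v ∈ S` finitely decomposed in `K_∞`, `γ` a topological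
generator. [cite: GreenbergVatsal2000, §2 Cor. (2.3) (arXiv:math/9906215 chunk p0043 L105–118)]
[cite: PollackWeston2011, Cor. 5.2 (arXiv:math/0610694 p0013 L30–34), App. A Prop. A.2] -/
def relaxQuotientEquiv {γ : absoluteGaloisGroup K} (hγ : κ.IsTopGenerator γ)
    {S S₀ : Finset (HeightOneSpectrum (𝓞 K))} (hS₀S : S₀ ⊆ S) (hS : ∀ v ∈ S, numPlacesAbove κ v ≠ 0)
    (hsurj : Function.Surjective (𝓛.globalToLocal κ γ S)) :
    ↥((𝓛.relax (↑S₀ : Set (HeightOneSpectrum (𝓞 K)))).selmer p S) ⧸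
        (𝓛.selmer p S).addSubgroupOf ((𝓛.relax (↑S₀ : Set (HeightOneSpectrum (𝓞 K)))).selmer p S) ≃+
      ((w : ↥S₀) → calH κ 𝓛 (w : HeightOneSpectrum (𝓞 K))) :=
  (QuotientAddGroup.quotientAddEquivOfEq
      (𝓛.ker_relaxToCalH_eq κ hγ (fun w hw ↦ hS w (hS₀S hw)) hS₀S).symm).trans
    (QuotientAddGroup.quotientKerEquivOfSurjective _
      (𝓛.relaxToCalH_surjective_of_globalToLocal_surjective κ hγ hS₀S hS hsurj))

/-- **Representative form of the surjectivity `Sel^{Σ₀} ↠ ∏_{w∈Σ₀} ℋ_w`**: granted the surjectivity of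
`γ` over `S ⊇ S₀`, for every family of local classes `y w i ∈ H¹(K_{∞,w₀}, A)` (`w ∈ S₀`,
`i < [Γ:Γ_w]`, the place `γ^{-i} w₀` read at `w₀` through `conj_{γ^i}`) there is ONE class
`c ∈ Sel^{Σ₀}(K_∞, A)` with `res_{w₀}(conj_{γ^i} c) ≡ y w i (mod 𝓛_{w₀})` for all of them.
[cite: GreenbergVatsal2000, §2 Cor. (2.3) (arXiv:math/9906215 chunk p0043 L105–118)]
[cite: PollackWeston2011, Cor. 5.2 (arXiv:math/0610694 p0013 L30–34), App. A Prop. A.2] -/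
theorem exists_mem_selmer_relax_forall_sub_mem {γ : absoluteGaloisGroup K} (hγ : κ.IsTopGenerator γ)
    {S S₀ : Finset (HeightOneSpectrum (𝓞 K))} (hS₀S : S₀ ⊆ S) (hS : ∀ v ∈ S, numPlacesAbove κ v ≠ 0)
    (hsurj : Function.Surjective (𝓛.globalToLocal κ γ S))
    (y : (w : HeightOneSpectrum (𝓞 K)) → ℕ → localH1 κ.kerSubgroup M w) :
    ∃ c ∈ (𝓛.relax (↑S₀ : Set (HeightOneSpectrum (𝓞 K)))).selmer p S,
      ∀ w ∈ S₀, ∀ i < numPlacesAbove κ w,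
        locRes κ.kerSubgroup M w (conjH1 κ.kerSubgroup M (γ ^ i) c) - y w i ∈ 𝓛.loc w := by
  obtain ⟨c, hc⟩ := 𝓛.relaxToCalH_surjective_of_globalToLocal_surjective κ hγ hS₀S hS hsurj
    fun w i ↦ ((y (w : HeightOneSpectrum (𝓞 K)) (i : ℕ) :
      localH1 κ.kerSubgroup M (w : HeightOneSpectrum (𝓞 K))) :
        localH1 κ.kerSubgroup M (w : HeightOneSpectrum (𝓞 K)) ⧸ 𝓛.loc (w : HeightOneSpectrum (𝓞 K)))
  refine ⟨c, c.2, fun w hw i hi ↦ ?_⟩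
  have h := congrFun (congrFun hc ⟨w, hw⟩) ⟨i, hi⟩
  rw [relaxToCalH_apply, toCalH_apply] at h
  exact QuotientAddGroup.eq_iff_sub_mem.1 h

/-- **Representative form with STRICT conditions at `S₀`** (`𝓛_{w₀} = 0` for `w ∈ S₀`, so that
`ℋ_w = ∏_{η∣w} H¹(K_{∞,η}, A)`): granted the surjectivity of `γ` over `S ⊇ S₀`, every family
`y w i ∈ H¹(K_{∞,w₀}, A)` (`w ∈ S₀`, `i < [Γ:Γ_w]`) is `(res_{w₀}(conj_{γ^i} c))_{w,i}` for ONE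
`c ∈ Sel^{Σ₀}(K_∞, A)` — the surjectivity of the canonical localisation
`Sel^{Σ₀} → ∏_{w∈Σ₀} ∏_{i<[Γ:Γ_w]} H¹(K_{∞,γ^{-i}w₀}, A)` in the shape the Summit-side consumers of
`KellerYin2024.prop125_residualPair_unrSelmer_corank_ge` take as hypothesis (representatives `γ^i`).
[cite: GreenbergVatsal2000, §2 Cor. (2.3) (arXiv:math/9906215 chunk p0043 L105–118)]
[cite: PollackWeston2011, Cor. 5.2 (arXiv:math/0610694 p0013 L30–34), App. A Prop. A.2]
[cite: KellerYin2024, Prop. 1.2.5 (arXiv:2402.12781v2 TeX L780–800)] -/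
theorem exists_mem_selmer_relax_forall_eq {γ : absoluteGaloisGroup K} (hγ : κ.IsTopGenerator γ)
    {S S₀ : Finset (HeightOneSpectrum (𝓞 K))} (hS₀S : S₀ ⊆ S) (hS : ∀ v ∈ S, numPlacesAbove κ v ≠ 0)
    (hsurj : Function.Surjective (𝓛.globalToLocal κ γ S))
    (hbot : ∀ w ∈ S₀, 𝓛.loc w = ⊥)
    (y : (w : HeightOneSpectrum (𝓞 K)) → ℕ → localH1 κ.kerSubgroup M w) :
    ∃ c ∈ (𝓛.relax (↑S₀ : Set (HeightOneSpectrum (𝓞 K)))).selmer p S,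
      ∀ w ∈ S₀, ∀ i < numPlacesAbove κ w,
        locRes κ.kerSubgroup M w (conjH1 κ.kerSubgroup M (γ ^ i) c) = y w i := by
  obtain ⟨c, hc, h⟩ := 𝓛.exists_mem_selmer_relax_forall_sub_mem κ hγ hS₀S hS hsurj y
  refine ⟨c, hc, fun w hw i hi ↦ ?_⟩
  have h' := h w hw i hi
  rwa [hbot w hw, AddSubgroup.mem_bot, sub_eq_zero] at h'

end SelmerStructure

end NonPrimitive

end Literature.NumberTheory.IwasawaTheory.PollackWeston2011

end
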